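import Literature.MathematicalPhysics.QuantumFieldTheory.Balaban1983to89.Node00.Record10
import Literature.MathematicalPhysics.QuantumFieldTheory.Balaban1983to89.Node00.Sect2FormOfRecord
import Literature.MathematicalPhysics.QuantumFieldTheory.Balaban1983to89.Node00.LargeFieldBackgroundOfRecord
import Literature.MathematicalPhysics.QuantumFieldTheory.Balaban1983to89.B12RegularSpaces111SpecialUnitary

/-!
# NODE 00 (YM-PLAN Track A) — STAGE 11: THE §2 [III] FORMAT PIN — the Stage-10 record with the residual format predicates `S218` ∕ `ScorrLaw`
# REPLACED by the §2 [III] form of record (11c `Sect2FormOfRecord`, identity read a.e.) at the slot families of the represented tower and def-R's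
# background maps of record; the complexified model of record for `SU(N)`; the record predicate `IsRecordOfRecord₁₁C`, its faces, its ₅C shadow refinement

Cell `pub-ymgap`, NODE 00, definer seat ₇b∕₉∕₁₀∕₁₁ (`pub-ymgap-node00-def-T`), DEDUP №11 tranche 11d (director LINE №54 ∕ №65 (c1)).  [I] = [Balaban1987RG1],
[III] = [Balaban1988Convergent], [IV] = [Balaban1989LargeFieldI], [II′] = [Balaban1989LargeFieldII].

WHAT THIS FILE IS.  Through Stage 10 the §2 [III] clause of the record — «`ρ_k` has the form (2.18), (2.23) with terms satisfying the inductive assumptions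
(2.24)–(2.42)», and the «corresponding space» clause of the 𝐓-image (remark p. 262, Def. p. 279) — were RESIDUAL PREDICATES `Residual₅.S218` ∕ `Stage9Params.ScorrLaw`
read at the densities of record (FORMAT FACE №38: junk-closable over the record class alone).  Stage 11 is the Stage-10 record OVER NEW PARAMETERS
`Stage11Params ⊇ Stage9Params` with exactly TWO PINS, each a NEW declaration (`Record10` untouched):
* (S) `S218OfRecord₁₁ θ p j σ :↔ rep_j(σ) ∧ HasSect2FormAE … j U_j(s) (slot family of ρ_j)` — `σ` is represented by the (2.18) representation of record AND the
  post-𝐑 slot family `s ↦ slot_j(s)` of the represented tower (`slotsOfRecord`, FILE 2 — FILE 1's recursion datum, never re-defined through `sect2Slot`) HAS THE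
  §2 FORM at index `j`: there are localized terms `𝐄^{(i)}, 𝐑^{(i)}, 𝐁^{(i)}` (`i ≤ j`, universal 𝐄) and constants `E_j(s)` obeying (i)–(iv) (2.27)–(2.28), (2.31),
  (2.41)–(2.42) + analyticity on the spaces of record, with `slot_j(s)(V_j) = (𝐓_j(s) exp A_j(s))(V_j)` for `dV_j`-a.e. `V_j` on the support of `χ_j(s)`;
* (T) `ScorrLawOfRecord₁₁ θ p k σ' :↔ Tstep rep_k(σ') ∧ HasSect2FormTAE … k U_{k+1}(s) (slot family of 𝐓ρ_k)` — the pre-𝐑 family `slotsTOfRecord … (k+1)` has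
  the 𝐓-IMAGE form: old terms as at `k`, new terms `E^{(k+1)}, R^{(k+1)}, B^{(k+1)}` with the improved decay `(1+4β)κ` (r11's `LFNewTerms`).
So pinned, the record's 𝐑-leaf `ROpLeaf` at the carriers `VOfRecord₁₁` reads «if `𝐓ρ_k` has the 𝐓-image form then `ρ_{k+1} = 𝐑𝐓ρ_k` has the §2 form at `k+1`»
(`rOpLeaf_VOfRecord₁₁_iff`) — THEOREM 2 [III]'s statement shape at the objects of record — and the core's `Sect2Form p k` IS `HasSect2FormAE` at the slots of `ρ_k`
(`sect2Form_stage11_iff`).  NOTHING of it is asserted.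

VERSION TYPING (a) (referee asks dag-ref-D PREREAD-11c ∕ dag-ref-B READ-336, option (a) ranked first by both; §1 of this file, generic in `V`, `𝔸`).  11c's
`HasSect2FormWith` demands the identity `slot_n(s)(V_n) = sect2Slot …(V_n)` at EVERY `V_n` of the χ-support; but both sides are VERSIONS in the tree — FILE 2's
slots run through the kernel transports of record and 11a's `𝐓_n(s)` through `kernelRT` = Radon–Nikodym derivative × disintegration kernel, each characterised only
`dV`-a.e. — while print's (2.21) fibre integrals are continuous functions, for which the distinction is void.  `HasSect2FormWithAE` ∕ `HasSect2FormAE` ∕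
`HasSect2FormTAE` read the identity `∀ᵐ V_n ∂(Π_b dV_n(b))` and keep everything else (the laws on the TERMS are sup-norm statements at the background, pointwise as in
print: `HasSect2FormAE.norm_E_bg_le`); adequate for every consumer, since `ρ_k` enters the next step only under the Haar integral.  11c's pointwise predicates
remain the stronger species (`HasSect2FormWith.toAE`).

THE NEW PARAMETERS (`Stage11Params`): `s2` — the §2 numerics (`O(1)LMB` of (I.1.12), `β, B, C, M` of (2.34)–(2.39), the regularity letter `O(L²)` =: `cR` of p. 256,
the term constants `Step.LFConsts` of (2.28), (2.31), (2.42)); `Rz K` — 11b's RESIDUAL §2 data per torus (the complex background functions `U_n(M˙(·))`,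
`U_{p,X}(M˙(·))` of (I.1.15)∕(2.35) = analytic continuations of [14]∕[15], and the smearing functions `φ_j`); `Wt K` — 11a's RESIDUAL 𝐓-weights ((2.21): `ζ`, the
quadratic forms, `χ(Y, S)`).  PINNED HERE, not parameters: the BACKGROUND MAPS `𝐖 ↦ U_n(s)(𝐖) = U(𝐁({Ω_j(s)}), 𝐖)` of (2.12)–(2.13)∕(2.19) = def-R's
`UbgOfRecord` (FILE 13 `LargeFieldBackgroundOfRecord`: FILE 1's minimiser of (2.12) on the determining set of the sequence at the regularity datum `χ_n(s)` reads;
`UbgOfRecord₁₁`), and the SUPPORT of the background proviso = def-R's regular retained configurations `regSuppOfRecord … cR` (p. 256 «|∂V_{j−1} − 1| < O(L²)ε_{j−1}»;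
`suppOfRecord₁₁`); the complexified value model `G = SU(N) ⊂ Gᶜ = SL(N, ℂ)`, `𝔤ᶜ = 𝔰𝔩(N, ℂ)` inside `𝔸 = M_N(ℂ)` with the `L²`-operator norm (pub-balaban's
`B12RegularSpaces111SpecialUnitary.suModel`, REUSED; the embedding `ιSU : SU(N) →* M_N(ℂ)ˣ`; 11b's model provisos `Setting.Laws` PROVED: `settingOfRecord₁₁_laws`);
the fluctuation value space `FluctV N = ℝ^{N²−1}` (a coordinate model of `𝔰𝔲(N)`; the fluctuation variables enter only through the residual weights and boundary
terms, so the chart is bookkeeping); the flow of the run `flowOfRun (gOfRecord₁₀ θ p) = (g_j, β_j)` with `β_j(·) := g_{j−1}^{−2} − g_j^{−2}` — the RG equations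
(0.20) [I] hold BY `ring` (`flowOfRun_satisfiesRG`).

PROVISOS (`Stage11Params.Provisos₁₁`, DISPLAYED, certified by a record, never asserted): `base` = `Provisos₁₀` of the Stage-9 part verbatim; `rzLaws` = 11c's
`Sect2.Residual.Laws` per torus (unit ↦ unit: the spaces of record are non-empty, `one_mem_spaceI_stage11` ∕ `one_mem_spaceMS_stage11`); `wtLaws` = 11a's
`TkWeights.Laws`; `alphaPos` = the radii `α_{0,j}, α_{1,j}` of (2.28) are positive along every generated history; `bg` = 11c's `BgProviso` — p. 259 «(2.7) imply
U_k ∈ U^c_j(X, α_{0,j}, α_{1,j})» — for def-R's background maps ON def-R's regular retained configurations, so that the bounds (2.27)(iv)∕(2.31)∕(2.42) bite at the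
backgrounds the slots are evaluated at (`norm_E_bg_le_stage11`, pointwise).  ADMISSIBILITY (`Stage11Params.Admissible`) = Stage-9 admissibility ∧ the sign
conditions `Sect2Numerics.Pos` (`0 < O(1)LMB`, `0 ≤ β < 1`, `0 < BCM`).

## HONEST FRAMING — what this is NOT

* Definitions of record and kernel bookkeeping (`rfl` ∕ `Iff.rfl` faces, instantiated adapters, one `ring`, one `filter_upwards`).  NOTHING of Bałaban's is
  asserted: Theorems 1–2 [III], (2.19)–(2.44), (1.1)–(1.2) [IV], [14]∕[15]'s existence ∕ analyticity and the estimates of [I] are what would CERTIFY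
  `HasSect2FormAE` ∕ `HasSect2FormTAE` ∕ the provisos for the objects of record; no node count moves (typed 28∕28 · discharged 5∕28).
* VACUITY STATUS.  `IsRecordOfRecord₁₁C` is inhabited iff SOME admissible `θ : Stage11Params` satisfies `Provisos₁₁`; the §2 pins are NOT provisos — they are
  what the 𝐑-leaf and the core's `Sect2Form` clause now SAY.  The pinned predicates are consistent and non-trivial: `hasSect2FormAE_zeroTerms` inhabits the form
  on the tautological family of pure slots under the RG equations (here theorems of the flow of the run) — class consistency only; for FILE 2's independent slot
  family inhabitation IS Theorem 1's content and is not claimed.  JUNK, located: (i) residual `Wt` ∕ `Rz` chosen junk change what `𝐓_n(s)` and the spaces ARE —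
  the name-level pins of the weights (11a's successor) and of the background functions remove that freedom; (ii) `bg` beyond print: for `cR·ε_j` outside [15]'s
  solvability radius the proviso asks regularity-space membership print does not give (a record chooses `cR`; consumers wanting the term bounds on the χ-support
  owe `supp χ_n(s) ⊆ regSuppOfRecord … cR`, def-R's side); off the solvable domain `UbgOfRecord = 1` and the clause holds by `rzLaws` (`UbgOfRecord_of_not_mem`).
* NOT TYPED (located, successors): the Euclidean covariance (2.29)∕(2.32)–(2.33) (r11 `Step.LFCov` needs a symmetry datum of record); the «slightly larger
  spaces» of the new terms (r11 D-f2.7); the (2.43) bookkeeping of `E_k`; a canonical continuous fibre-integral version of `𝐓_n(s)` (VERSION option (c)); K0 at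
  `N ≥ 2` exactly as located in `Record10`'s header (inherited clauses read representatives).  RIDER №7: N-generic (`[NeZero N]`), no K0 stated; the route
  instantiates `F 2`.
* `IsRecordOfRecord₁₁C → IsRecordOfRecord₁₀C` does NOT hold at the datum (the constructions differ in the `Sect2Form` clause and the carriers' laws: two
  `FiniteEpsData` terms); what holds is the ₅C refinement AT THE SHADOW with the SAME `C`, `dens`, `βfun`, `av` (`exists_isRecordOfRecord₅C_of_isRecordOfRecord₁₁C`),
  and every world-reading ₅C theorem transfers (§8).  CARRIERS: as at ₁₀ (only `V` pinned; node00-def's suffix recipe re-instantiates on `Stage11Params`).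
* One finite four-torus programme at fixed `ε` — NOT the continuum limit on ℝ⁴, NOT infinite volume, NOT OS, NOT a mass gap, NOT the Clay problem.
-/

noncomputable section

open MeasureTheory
open scoped Matrix.Norms.L2Operator

namespace Literature.MathematicalPhysics.QuantumFieldTheory.Balaban1983to89.Node00

open T4Continuum AveragingRT T4FiniteEpsInhabited FlowStep FlowStepRuns DagBinding T4DatumAssembly
open B12Eq019ActionBody (integrand)

/-! ## §1. The a.e. reading of the §2 [III] form (VERSION typing (a): generic in `V`, `𝔸`) -/

section Sect2FormAE

open Tk

variable (F : T4Family) (N : ℕ) [NeZero N] (V : Type) [NormedAddCommGroup V] [InnerProductSpace ℝ V] [FiniteDimensional ℝ V]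
  [MeasurableSpace V] [BorelSpace V] {𝔸 : Type*} [NormedRing 𝔸] [NormedAlgebra ℂ 𝔸] [CompleteSpace 𝔸]

/-- **THE §2 FORM OF A SLOT FAMILY, WITH A LAW PACKAGE, IDENTITY READ ALMOST EVERYWHERE** (VERSION typing (a)): as 11c's `HasSect2FormWith` — term values `t s`
universal in 𝐄, constants `E_n(s)`, every `t s` obeying `law s` — but the identity `slot_n(s) = 𝐓_n(s) exp A_n(s)` on the support of `χ_n(s)` is demanded for
`dV_n`-ALMOST EVERY `V_n` (product Haar measure): both sides are VERSIONS in the tree (FILE 2's slots through the kernel transports of record; 11a's `𝐓_n(s)`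
through `kernelRT` = Radon–Nikodym derivative × disintegration kernel), characterised a.e.; in print the (2.21) fibre integrals are continuous and the
distinction is void. [cite: Balaban1988Convergent, (2.18) p.257, (2.21) p.258, (2.23)–(2.42) pp.258–261, Thm 1 p.262] -/
def HasSect2FormWithAE (K : ℕ) (S : Sect2.Setting 𝔸 (SU N)) (Rz : Sect2.Residual (F.P K) 𝔸) (W : TkWeights F N V K) {ν : Stage7Numerics} {M : ℕ}
    {g : ℕ → ℝ} (n : ℕ) (U : SeqOfRecord F ν M g K n → BgMap F N K)
    (law : SeqOfRecord F ν M g K n → Sect2.TermValues (F.P K) 𝔸 V M → Prop) (slot : SeqOfRecord F ν M g K n → Density (F.P K) n (SU N)) : Prop :=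
  ∃ (t : SeqOfRecord F ν M g K n → Sect2.TermValues (F.P K) 𝔸 V M) (Ek : SeqOfRecord F ν M g K n → ℝ),
    Sect2.UniversalE t ∧ ∀ s, law s (t s) ∧
      ∀ᵐ Vn ∂(fieldMeasure (F.P K) n (SU N)), chiSeqOfRecord F N ν M g K n s Vn ≠ 0 → slot s Vn = sect2Slot F N V K S Rz W s (t s) (Ek s) (U s) Vn

/-- **THE §2 FORM AT INDEX `k`, a.e. reading** — `HasSect2FormWithAE` with the inductive assumptions `Sect2.LawsRT … k` on the tower of record (11c's
`HasSect2Form`, identity a.e.). [cite: Balaban1988Convergent, Thm 1 p.262, (2.18) p.257, (2.23) p.258] -/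
def HasSect2FormAE (K : ℕ) (S : Sect2.Setting 𝔸 (SU N)) (Rz : Sect2.Residual (F.P K) 𝔸) (W : TkWeights F N V K) {ν : Stage7Numerics} {M : ℕ}
    {g : ℕ → ℝ} (k : ℕ) (U : SeqOfRecord F ν M g K k → BgMap F N K) (slot : SeqOfRecord F ν M g K k → Density (F.P K) k (SU N)) : Prop :=
  HasSect2FormWithAE F N V K S Rz W k U (fun s t => Sect2.LawsRT (sect2TowerOfRecord F N V K S Rz s t) S.lf k) slot

/-- **THE §2 FORM OF THE 𝐓-IMAGE, a.e. reading** — `HasSect2FormWithAE` at length `k+1` with `Sect2.LawsT … k` (11c's `HasSect2FormT`, identity a.e.).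
[cite: Balaban1988Convergent, §2 p.262, §3 p.279] -/
def HasSect2FormTAE (K : ℕ) (S : Sect2.Setting 𝔸 (SU N)) (Rz : Sect2.Residual (F.P K) 𝔸) (W : TkWeights F N V K) {ν : Stage7Numerics} {M : ℕ}
    {g : ℕ → ℝ} (k : ℕ) (U : SeqOfRecord F ν M g K (k + 1) → BgMap F N K)
    (slotT : SeqOfRecord F ν M g K (k + 1) → Density (F.P K) (k + 1) (SU N)) : Prop :=
  HasSect2FormWithAE F N V K S Rz W (k + 1) U (fun s t => Sect2.LawsT (sect2TowerOfRecord F N V K S Rz s t) S.lf S.βc k) slotT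

variable {F N V}

/-- **11c's POINTWISE form implies the a.e. form** (the stronger species survives). [cite: Balaban1988Convergent, (2.18) p.257 (bookkeeping)] -/
theorem HasSect2FormWith.toAE {K : ℕ} {S : Sect2.Setting 𝔸 (SU N)} {Rz : Sect2.Residual (F.P K) 𝔸} {W : TkWeights F N V K} {ν : Stage7Numerics}
    {M : ℕ} {g : ℕ → ℝ} {n : ℕ} {U : SeqOfRecord F ν M g K n → BgMap F N K}
    {law : SeqOfRecord F ν M g K n → Sect2.TermValues (F.P K) 𝔸 V M → Prop} {slot : SeqOfRecord F ν M g K n → Density (F.P K) n (SU N)}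
    (h : HasSect2FormWith F N V K S Rz W n U law slot) : HasSect2FormWithAE F N V K S Rz W n U law slot := by
  obtain ⟨t, Ek, hu, hs⟩ := h
  exact ⟨t, Ek, hu, fun s => ⟨(hs s).1, Filter.Eventually.of_forall (hs s).2⟩⟩

/-- … at index `k`. [cite: Balaban1988Convergent, Thm 1 p.262 (bookkeeping)] -/
theorem HasSect2Form.toAE {K : ℕ} {S : Sect2.Setting 𝔸 (SU N)} {Rz : Sect2.Residual (F.P K) 𝔸} {W : TkWeights F N V K} {ν : Stage7Numerics}
    {M : ℕ} {g : ℕ → ℝ} {k : ℕ} {U : SeqOfRecord F ν M g K k → BgMap F N K} {slot : SeqOfRecord F ν M g K k → Density (F.P K) k (SU N)}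
    (h : HasSect2Form F N V K S Rz W k U slot) : HasSect2FormAE F N V K S Rz W k U slot :=
  HasSect2FormWith.toAE h

/-- … and for the 𝐓-image. [cite: Balaban1988Convergent, §2 p.262 (bookkeeping)] -/
theorem HasSect2FormT.toAE {K : ℕ} {S : Sect2.Setting 𝔸 (SU N)} {Rz : Sect2.Residual (F.P K) 𝔸} {W : TkWeights F N V K} {ν : Stage7Numerics}
    {M : ℕ} {g : ℕ → ℝ} {k : ℕ} {U : SeqOfRecord F ν M g K (k + 1) → BgMap F N K}
    {slotT : SeqOfRecord F ν M g K (k + 1) → Density (F.P K) (k + 1) (SU N)} (h : HasSect2FormT F N V K S Rz W k U slotT) :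
    HasSect2FormTAE F N V K S Rz W k U slotT :=
  HasSect2FormWith.toAE h

/-- The a.e. predicate is monotone in the law package. [cite: Balaban1988Convergent, Thm 1 p.262 (bookkeeping)] -/
theorem hasSect2FormWithAE_mono {K : ℕ} {S : Sect2.Setting 𝔸 (SU N)} {Rz : Sect2.Residual (F.P K) 𝔸} {W : TkWeights F N V K} {ν : Stage7Numerics}
    {M : ℕ} {g : ℕ → ℝ} {n : ℕ} {U : SeqOfRecord F ν M g K n → BgMap F N K}
    {law law' : SeqOfRecord F ν M g K n → Sect2.TermValues (F.P K) 𝔸 V M → Prop} (hl : ∀ s t, law s t → law' s t)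
    {slot : SeqOfRecord F ν M g K n → Density (F.P K) n (SU N)} (h : HasSect2FormWithAE F N V K S Rz W n U law slot) :
    HasSect2FormWithAE F N V K S Rz W n U law' slot := by
  obtain ⟨t, Ek, hu, hs⟩ := h
  exact ⟨t, Ek, hu, fun s => ⟨hl s _ (hs s).1, (hs s).2⟩⟩

/-- p. 262 ∕ p. 279 on the a.e. predicate: a 𝐓-image family of §2 form satisfies the inductive assumptions at index `k+1` under r11's sign conditions (11c's
`LawsT.toRT_succ`). [cite: Balaban1988Convergent, §2 p.262, §3 p.279] -/
theorem HasSect2FormTAE.toFormAE_succ {K : ℕ} {S : Sect2.Setting 𝔸 (SU N)} {Rz : Sect2.Residual (F.P K) 𝔸} {W : TkWeights F N V K} {ν : Stage7Numerics}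
    {M : ℕ} {g : ℕ → ℝ} {k : ℕ} {U : SeqOfRecord F ν M g K (k + 1) → BgMap F N K}
    {slotT : SeqOfRecord F ν M g K (k + 1) → Density (F.P K) (k + 1) (SU N)} (h : HasSect2FormTAE F N V K S Rz W k U slotT) (hβ : 0 ≤ S.βc)
    (hκ : 0 ≤ S.lf.κ) (hE₀ : 0 ≤ S.lf.E₀) (hB₀ : 0 ≤ S.lf.B₀) (hg : 0 ≤ S.flow.g (k + 1)) :
    HasSect2FormAE F N V K S Rz W (k + 1) U slotT :=
  hasSect2FormWithAE_mono (fun _ _ hl => hl.toRT_succ hβ hκ hE₀ hB₀ hg) h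

/-- **ALMOST EVERYWHERE ON THE χ-SUPPORT A SLOT OF §2 FORM IS NONNEGATIVE** (under the weight laws; 11c's `sect2Slot_nonneg`). [cite: Balaban1988Convergent, (2.18) p.257, (2.21) p.258] -/
theorem HasSect2FormWithAE.slot_nonneg_ae {K : ℕ} {S : Sect2.Setting 𝔸 (SU N)} {Rz : Sect2.Residual (F.P K) 𝔸} {W : TkWeights F N V K} (hW : W.Laws)
    {ν : Stage7Numerics} {M : ℕ} {g : ℕ → ℝ} {n : ℕ} {U : SeqOfRecord F ν M g K n → BgMap F N K}
    {law : SeqOfRecord F ν M g K n → Sect2.TermValues (F.P K) 𝔸 V M → Prop} {slot : SeqOfRecord F ν M g K n → Density (F.P K) n (SU N)}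
    (h : HasSect2FormWithAE F N V K S Rz W n U law slot) (s : SeqOfRecord F ν M g K n) :
    ∀ᵐ Vn ∂(fieldMeasure (F.P K) n (SU N)), chiSeqOfRecord F N ν M g K n s Vn ≠ 0 → 0 ≤ slot s Vn := by
  obtain ⟨t, Ek, -, hs⟩ := h
  filter_upwards [(hs s).2] with Vn hVn hχ
  rw [hVn hχ]
  exact sect2Slot_nonneg K S Rz hW s (t s) (Ek s) (U s) Vn

/-- INHABITATION of the a.e. predicate by the family of pure slots (11c's `hasSect2Form_zeroTerms`, weakened) — consistency of the predicate; on an INDEPENDENT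
slot family it is Theorem 1's content, not claimed. [cite: Balaban1988Convergent, Thm 1 p.262, (2.23) p.258; Balaban1987RG1, (0.20) p.256] -/
theorem hasSect2FormAE_zeroTerms (K : ℕ) (S : Sect2.Setting 𝔸 (SU N)) (Rz : Sect2.Residual (F.P K) 𝔸) (W : TkWeights F N V K) {ν : Stage7Numerics}
    {M : ℕ} {g : ℕ → ℝ} (k : ℕ) (U : SeqOfRecord F ν M g K k → BgMap F N K) (Ek : SeqOfRecord F ν M g K k → ℝ) (hrg : S.flow.SatisfiesRG k)
    (hE₀ : 0 ≤ S.lf.E₀) (hB₀ : 0 ≤ S.lf.B₀) (hg : ∀ j, j ≤ k → 0 ≤ S.flow.g j) :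
    HasSect2FormAE F N V K S Rz W k U (fun s => sect2Slot F N V K S Rz W s Sect2.TermValues.zero (Ek s) (U s)) :=
  (hasSect2Form_zeroTerms K S Rz W k U Ek hrg hE₀ hB₀ hg).toAE

/-- **THE BOUND (2.27)(iv) BITES AT THE BACKGROUND OF RECORD** (a.e. predicate; the law half is untouched by the version reading): under the §2 form at index `k`
and the background proviso on `Supp`, the witnessing 𝐄-terms obey `|𝐄^{(j)}(X, U_k(𝐖), z)| ≤ E₀ exp(−κ d_j(X))` at every `𝐖 ∈ Supp s` — POINTWISE, as print.
[cite: Balaban1988Convergent, (2.23) p.258, (2.27)(iv)–(2.28) p.259] -/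
theorem HasSect2FormAE.norm_E_bg_le {K : ℕ} {S : Sect2.Setting 𝔸 (SU N)} {Rz : Sect2.Residual (F.P K) 𝔸} {W : TkWeights F N V K} {ν : Stage7Numerics}
    {M : ℕ} {g : ℕ → ℝ} {k : ℕ} {U : SeqOfRecord F ν M g K k → BgMap F N K} {slot : SeqOfRecord F ν M g K k → Density (F.P K) k (SU N)}
    (h : HasSect2FormAE F N V K S Rz W k U slot) {Supp : SeqOfRecord F ν M g K k → Set (B15DeterminingSets.MSField (F.P K) (SU N))}
    (hU : BgProviso F N K S Rz M k Supp U) :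
    ∃ t : SeqOfRecord F ν M g K k → Sect2.TermValues (F.P K) 𝔸 V M, Sect2.UniversalE t ∧
      ∀ s Wc, Wc ∈ Supp s → ∀ j, 1 ≤ j → j ≤ k → ∀ (X : (Sect2.domSys (F.P K) M j).Dom) (z : Site (F.P K) j) (g' : ℝ), 0 ≤ g' → g' ≤ S.lf.γ →
        ‖(t s).E j X z g' (Sect2.ofBackgroundC S.ι (U s Wc))‖ ≤ S.lf.E₀ * Real.exp (-S.lf.κ * (Sect2.domSys (F.P K) M j).dj X) := by
  obtain ⟨t, Ek, hu, hs⟩ := h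
  refine ⟨t, hu, fun s Wc hW j h1 hj X z g' hg0 hgγ => ?_⟩
  exact (hs s).1.1.boundE j h1 hj X z g' _ hg0 hgγ (hU s Wc hW j h1 hj X).1

end Sect2FormAE

/-! ## §2. The complexified model of record for `SU(N)`; the fluctuation value space; the flow of a run -/

section Model

variable (N : ℕ)

/-- `𝔸 = M_N(ℂ)`, print's matrix algebra carrying `G ⊂ Gᶜ` ([I] p. 251–252), with Mathlib's `L²`-operator norm (scope `Matrix.Norms.L2Operator`).
[cite: Balaban1987RG1, pp.251–252] -/
abbrev MatA : Type := Matrix (Fin N) (Fin N) ℂ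

/-- **The embedding `SU(N) →* M_N(ℂ)ˣ`** (`U ↦ U` as a unit, `U⁻¹ = U⋆`): Mathlib's `Unitary.toUnits` after the inclusion `SU(N) ≤ U(N)`.
[cite: Balaban1987RG1, pp.251–252] -/
def ιSU : SU N →* (MatA N)ˣ :=
  (Unitary.toUnits).comp (Submonoid.inclusion Matrix.specialUnitaryGroup_le_unitaryGroup)

/-- The embedded unit IS the matrix. [cite: Balaban1987RG1, pp.251–252 (bookkeeping)] -/
theorem coe_ιSU (U : SU N) : ((ιSU N U : (MatA N)ˣ) : MatA N) = (U : MatA N) := rfl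

/-- The embedding lands in the model's `G = SU(N)` (pub-balaban's `toUnits_mem_G`). [cite: Balaban1987RG1, pp.251–252] -/
theorem ιSU_mem_G (U : SU N) : ιSU N U ∈ (B12RegularSpaces111SpecialUnitary.suModel N).G :=
  B12RegularSpaces111SpecialUnitary.toUnits_mem_G U

/-- **THE FLUCTUATION VALUE SPACE OF RECORD** `ℝ^{N²−1}` — a coordinate model of `𝔰𝔲(N)` for the fluctuation variables `A_j` of (2.19)–(2.21) (they enter the
objects of record only through the residual 𝐓-weights and the boundary terms `𝐁^{(j)}(X, ·, a)`). [cite: Balaban1988Convergent, (2.19)–(2.21) p.258] -/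
abbrev FluctV : Type := EuclideanSpace ℝ (Fin (N ^ 2 - 1))

end Model

/-- **THE FLOW OF A RUN** with coupling history `g`: `(g_j, β_j)` with `β_j(·) := g_{j−1}^{−2} − g_j^{−2}` — the increment the history realises, so that the RG
equations (0.20) [I] `g_j^{−2} = g_{j+1}^{−2} + β_{j+1}(g_j)` hold identically. [cite: Balaban1987RG1, (0.20) p.256] -/
def flowOfRun (g : ℕ → ℝ) : Flow where
  g := g
  β := fun j _ => 1 / g (j - 1) ^ 2 - 1 / g j ^ 2

/-- The flow of a run carries the history (`rfl`). [cite: Balaban1987RG1, (0.20) p.256 (bookkeeping)] -/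
theorem flowOfRun_g (g : ℕ → ℝ) : (flowOfRun g).g = g := rfl

/-- **THE RG EQUATIONS HOLD FOR THE FLOW OF A RUN**, at every index (`ring`). [cite: Balaban1987RG1, (0.20) p.256] -/
theorem flowOfRun_satisfiesRG (g : ℕ → ℝ) (k : ℕ) : (flowOfRun g).SatisfiesRG k := by
  intro j _
  show 1 / g j ^ 2 = 1 / g (j + 1) ^ 2 + (1 / g (j + 1 - 1) ^ 2 - 1 / g (j + 1) ^ 2)
  rw [Nat.add_sub_cancel]
  ring

/-! ## §3. Stage-11 parameters, admissibility, the setting of record; the background maps and support of record (def-R's, pinned) -/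

/-- **THE §2 NUMERICS**: `O(1)LMB` of (I.1.12), `β, B, C, M` of (2.34)–(2.39), the regularity constant `O(L²)` of p. 256 (def-R's located letter) and the term
constants of (2.28), (2.31), (2.42) (print's «O(1) constants to be determined»). [cite: Balaban1987RG1, (1.12) p.262; Balaban1988Convergent, (2.10) p.256, (2.28) p.259, (2.31) p.260, (2.34)–(2.39) p.261, (2.42) p.261] -/
structure Sect2Numerics where
  /-- `O(1)LMB` of (I.1.12) -/
  cB : ℝ
  /-- `β` of (2.34)–(2.39) -/
  βc : ℝ
  /-- `B` of (2.38) -/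
  B : ℝ
  /-- `C` of (2.38) -/
  C : ℝ
  /-- `M` of (2.38) (real) -/
  Mr : ℝ
  /-- the located constant `O(L²)` of p. 256 («|∂V_{j−1} − 1| < O(L²)ε_{j−1}»; def-R's letter `cR` of `regSuppOfRecord`) -/
  cR : ℝ
  /-- the term constants `A₀, p₀, C₀, q₀, C₁, q₁, κ, κ₀, E₀, B₀, γ` -/
  lf : Step.LFConsts

/-- **THE SIGN CONDITIONS** of the §2 numerics: `0 < O(1)LMB`, `0 ≤ β < 1` («e.g., we can take β = 1∕4», p. 261), `0 < BCM`. [cite: Balaban1987RG1, (1.12) p.262; Balaban1988Convergent, (2.34)–(2.39) p.261] -/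
def Sect2Numerics.Pos (n : Sect2Numerics) : Prop :=
  0 < n.cB ∧ 0 ≤ n.βc ∧ n.βc < 1 ∧ 0 < n.B * n.C * n.Mr

/-- **Stage-11 family parameters**: the Stage-9 parameters and — for the §2 [III] format pin — the §2 numerics `s2`, 11b's RESIDUAL §2 data `Rz K` per torus
(complex background functions of (I.1.15)∕(2.35), smearing functions) and 11a's RESIDUAL 𝐓-weights `Wt K` ((2.21)).  The background maps `𝐖 ↦ U_n(𝐁_n(s), 𝐖)`
of (2.12)–(2.13)∕(2.19) are NOT parameters: def-R's `UbgOfRecord` (FILE 13) is PINNED below.  (Inside this declaration `F` is the inherited flow field of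
`Stage1Params`; the family is `Fam`.) [cite: Balaban1988Convergent, (2.19)–(2.21) p.258, (2.28) p.259, (2.35) p.261; Balaban1987RG1, (1.12)–(1.15) p.262] -/
structure Stage11Params (Fam : T4Family) (N : ℕ) [NeZero N] extends Stage9Params Fam N where
  /-- the §2 numerics -/
  s2 : Sect2Numerics
  /-- RESIDUAL: 11b's §2 data per torus (complex background functions, smearing functions) -/
  Rz : (K : ℕ) → Sect2.Residual (Fam.P K) (MatA N)
  /-- RESIDUAL: 11a's 𝐓-weights per torus -/
  Wt : (K : ℕ) → TkWeights Fam N (FluctV N) K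

variable (F : T4Family) (N : ℕ) [NeZero N]

/-- **Admissibility at Stage 11** = Stage-9 admissibility ∧ the sign conditions of the §2 numerics.  NO clause constrains a residual object.
[cite: Balaban1987RG1, (1.12) p.262; Balaban1988Convergent, (2.34)–(2.39) p.261 (hypothesis dictionary)] -/
def Stage11Params.Admissible (θ : Stage11Params F N) : Prop :=
  θ.toStage9Params.Admissible ∧ θ.s2.Pos

variable {F N} in
/-- Stage-11 admissibility refines Stage-9 admissibility. [cite: Balaban1987RG1, (0.21) p.256 (bookkeeping)] -/
theorem Stage11Params.Admissible.toStage9 {θ : Stage11Params F N} (h : θ.Admissible) : θ.toStage9Params.Admissible := h.1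

variable {F N} in
/-- … and carries the sign conditions. [cite: Balaban1988Convergent, (2.34)–(2.39) p.261 (bookkeeping)] -/
theorem Stage11Params.Admissible.pos {θ : Stage11Params F N} (h : θ.Admissible) : θ.s2.Pos := h.2

/-- The term constants of record: the §2 numerics' `LFConsts` with the coupling window `γ` OF THE RECORD (`θ.γ`, the one small-coupling letter).
[cite: Balaban1988Convergent, (2.27)(iii)–(2.28) p.259] -/
def lfOfRecord₁₁ (θ : Stage11Params F N) : Step.LFConsts :=
  { θ.s2.lf with γ := θ.γ }

/-- **THE §2 SETTING OF RECORD of the run `p`** (11b's `Sect2.Setting`): the `SU(N)` model PINNED (`suModel`, `ιSU`), the §2 numerics, the term constants of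
record, and the flow of the run along the ONE generated history `gOfRecord₁₀`. [cite: Balaban1987RG1, pp.251–252, (1.12) p.262, (0.20) p.256; Balaban1988Convergent, (2.28) p.259, (2.34)–(2.39) p.261] -/
def settingOfRecord₁₁ (θ : Stage11Params F N) (p : B12.RunParams) : Sect2.Setting (MatA N) (SU N) where
  𝓜 := B12RegularSpaces111SpecialUnitary.suModel N
  ι := ιSU N
  cB := θ.s2.cB
  βc := θ.s2.βc
  B := θ.s2.B
  C := θ.s2.C
  Mr := θ.s2.Mr
  lf := lfOfRecord₁₁ F N θ
  flow := flowOfRun (gOfRecord₁₀ F N θ.toStage9Params p)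

/-- **11b's MODEL PROVISOS DISCHARGED BY CONSTRUCTION**: `ι(SU(N)) ⊂ G` and `G ⊂ Gᶜ = SL(N, ℂ)` (pub-balaban's `toUnits_mem_G`, `suModel_G_le_Gc`).
[cite: Balaban1987RG1, pp.251–252, (1.10)–(1.11) p.262] -/
theorem settingOfRecord₁₁_laws (θ : Stage11Params F N) (p : B12.RunParams) : (settingOfRecord₁₁ F N θ p).Laws :=
  ⟨fun U => ιSU_mem_G N U, B12RegularSpaces111SpecialUnitary.suModel_G_le_Gc⟩

/-- The setting's sign conditions ARE the numerics' (11c's `Setting.Pos` from `Sect2Numerics.Pos`). [cite: Balaban1988Convergent, (2.34)–(2.39) p.261 (bookkeeping)] -/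
theorem settingOfRecord₁₁_pos (θ : Stage11Params F N) (hθ : θ.s2.Pos) (p : B12.RunParams) : (settingOfRecord₁₁ F N θ p).Pos :=
  ⟨hθ.1, hθ.2.1, hθ.2.2.1, hθ.2.2.2⟩

/-- The setting's flow satisfies the RG equations at every index (`flowOfRun_satisfiesRG`). [cite: Balaban1987RG1, (0.20) p.256] -/
theorem settingOfRecord₁₁_satisfiesRG (θ : Stage11Params F N) (p : B12.RunParams) (k : ℕ) : (settingOfRecord₁₁ F N θ p).flow.SatisfiesRG k :=
  flowOfRun_satisfiesRG _ k

/-- The setting's couplings ARE the generated history (`rfl`). [cite: Balaban1987RG1, (0.17)–(0.20) pp.255–256 (bookkeeping)] -/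
theorem settingOfRecord₁₁_flow_g (θ : Stage11Params F N) (p : B12.RunParams) :
    (settingOfRecord₁₁ F N θ p).flow.g = gOfRecord₁₀ F N θ.toStage9Params p := rfl

/-- **THE BACKGROUND MAPS OF RECORD of the run `p` at length `n`** — def-R's `UbgOfRecord` (FILE 13: `U_n(s)(𝐖) = U(𝐁({Ω_j(s)}), 𝐖)`, FILE 1's minimiser of
(2.12) on the determining set of the sequence, junk `1` off the solvable domain) along the generated history of the run: the map 11c's `BgMap` slot is
PINNED to. [cite: Balaban1988Convergent, (2.12)–(2.13) pp.256–257, §2 p.258] -/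
def UbgOfRecord₁₁ (θ : Stage11Params F N) (p : B12.RunParams) (n : ℕ) :
    SeqOfRecord F θ.ν θ.τ9.M (gOfRecord₁₀ F N θ.toStage9Params p) p.K n → BgMap F N p.K :=
  UbgOfRecord F N θ.ν θ.τ9.M (gOfRecord₁₀ F N θ.toStage9Params p) p.K n

/-- **THE SUPPORT OF RECORD of the background proviso** — def-R's REGULAR RETAINED CONFIGURATIONS `regSuppOfRecord` (FILE 13; p. 256 «we assume that the field
V_{j−1} is regular on Γ_{j−1} in the sense that |∂V_{j−1} − 1| < O(L²)ε_{j−1}») at `θ`'s located letter `cR` along the generated history of the run.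
[cite: Balaban1988Convergent, (2.10) p.256, (2.28) p.259] -/
def suppOfRecord₁₁ (θ : Stage11Params F N) (p : B12.RunParams) (n : ℕ) :
    SeqOfRecord F θ.ν θ.τ9.M (gOfRecord₁₀ F N θ.toStage9Params p) p.K n → Set (B15DeterminingSets.MSField (F.P p.K) (SU N)) :=
  regSuppOfRecord F N θ.ν θ.τ9.M (gOfRecord₁₀ F N θ.toStage9Params p) p.K n θ.s2.cR

/-- The pinned background map unfolds to FILE 1's minimiser on `𝐁({Ω_j(s)})` (`rfl`, def-R's `UbgOfRecord_apply`). [cite: Balaban1988Convergent, (2.13) p.257 (bookkeeping)] -/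
theorem UbgOfRecord₁₁_apply (θ : Stage11Params F N) (p : B12.RunParams) (n : ℕ)
    (s : SeqOfRecord F θ.ν θ.τ9.M (gOfRecord₁₀ F N θ.toStage9Params p) p.K n) (W : B15DeterminingSets.MSField (F.P p.K) (SU N)) :
    UbgOfRecord₁₁ F N θ p n s W =
      UminOfRecord (avOfRecord F N p.K) (regLFOfRecord F N θ.ν p.K n) (B15DeterminingSets.genSet s.Ω n) W := rfl

/-! ## §4. THE TWO PINS: `S218OfRecord₁₁`, `ScorrLawOfRecord₁₁`; the carriers, the residual, the view, the core -/

/-- **THE §2 [III] FORMAT PREDICATE OF RECORD** for step-`j` densities of the run `p`: `σ` IS REPRESENTED by `rep_j` of record ((2.18) with the sequences, `χ_j(s)`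
and slots of record) AND the post-𝐑 slot family of record has the §2 FORM at index `j`, a.e. reading (`HasSect2FormAE`: localized terms obeying the inductive
assumptions on the spaces of record, universal 𝐄, `slot_j(s) = 𝐓_j(s) exp A_j(s)` for a.e. `V_j` on the χ-support) — at the setting of record, the residual §2
data and 𝐓-weights of `θ`, and def-R's background maps of record. [cite: Balaban1988Convergent, (2.18) p.257, (2.23)–(2.42) pp.258–261, Thm 1 p.262] -/
def S218OfRecord₁₁ (θ : Stage11Params F N) (p : B12.RunParams) (j : ℕ) (σ : Density (F.P p.K) j (SU N)) : Prop :=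
  (reprOfRecord₁₀ F N θ.toStage9Params p j).Holds σ ∧
    HasSect2FormAE F N (FluctV N) p.K (settingOfRecord₁₁ F N θ p) (θ.Rz p.K) (θ.Wt p.K) j
      (UbgOfRecord₁₁ F N θ p j)
      (slotsOfRecord F N θ.ν θ.τ9 (EOfRecord₁₀ F N θ.toStage9Params) (wOfRecord₉ F N θ.toStage9Params) θ.ppSel p
        (gOfRecord₁₀ F N θ.toStage9Params p) j)

/-- **THE «CORRESPONDING SPACE» PREDICATE OF RECORD** for the 𝐓-image at step `k+1`: `σ'` IS REPRESENTED by `Tstep rep_k` of record AND the pre-𝐑 slot family of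
record at level `k+1` has the 𝐓-IMAGE FORM, a.e. reading (`HasSect2FormTAE`: old terms as at `k`, new terms `E^{(k+1)}, R^{(k+1)}, B^{(k+1)}` with the
improved decay `(1+4β)κ`). [cite: Balaban1988Convergent, remark p.262, Def. p.279, (3.25) p.270] -/
def ScorrLawOfRecord₁₁ (θ : Stage11Params F N) (p : B12.RunParams) (k : ℕ) (σ' : Density (F.P p.K) (k + 1) (SU N)) : Prop :=
  (reprTOfRecord₁₀ F N θ.toStage9Params p k).Holds σ' ∧
    HasSect2FormTAE F N (FluctV N) p.K (settingOfRecord₁₁ F N θ p) (θ.Rz p.K) (θ.Wt p.K) k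
      (UbgOfRecord₁₁ F N θ p (k + 1))
      (slotsTOfRecord F N θ.ν θ.τ9 (EOfRecord₁₀ F N θ.toStage9Params) (wOfRecord₉ F N θ.toStage9Params) θ.ppSel p
        (gOfRecord₁₀ F N θ.toStage9Params p) (k + 1))

/-- **`SLaw₁₁ θ p j`** — the §2 format law of `ρ_j` OF RECORD: `S218OfRecord₁₁` READ AT `densOfRecord₁₀`. [cite: Balaban1988Convergent, (2.18) p.257, Thm 1 p.262] -/
def SLaw₁₁ (θ : Stage11Params F N) (p : B12.RunParams) (j : ℕ) : Prop :=
  S218OfRecord₁₁ F N θ p j (densOfRecord₁₀ F N θ.toStage9Params p j)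

/-- **`TLaw₁₁ θ p k`** — the «corresponding space» law of `𝐓ρ_k` OF RECORD: `ScorrLawOfRecord₁₁` READ AT `tdensOfRecord₁₀`. [cite: Balaban1988Convergent, remark p.262, Def. p.279] -/
def TLaw₁₁ (θ : Stage11Params F N) (p : B12.RunParams) (k : ℕ) : Prop :=
  ScorrLawOfRecord₁₁ F N θ p k (tdensOfRecord₁₀ F N θ.toStage9Params p k)

/-- `SLaw₁₁` IS the §2 form of the post-𝐑 slot family (the representation clause holds by construction, `holds_densOfRecord₁₀`). [cite: Balaban1988Convergent, (2.18) p.257, Thm 1 p.262] -/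
theorem sLaw₁₁_iff (θ : Stage11Params F N) (p : B12.RunParams) (j : ℕ) :
    SLaw₁₁ F N θ p j ↔ HasSect2FormAE F N (FluctV N) p.K (settingOfRecord₁₁ F N θ p) (θ.Rz p.K) (θ.Wt p.K) j
      (UbgOfRecord₁₁ F N θ p j)
      (slotsOfRecord F N θ.ν θ.τ9 (EOfRecord₁₀ F N θ.toStage9Params) (wOfRecord₉ F N θ.toStage9Params) θ.ppSel p
        (gOfRecord₁₀ F N θ.toStage9Params p) j) :=
  ⟨fun h => h.2, fun h => ⟨holds_densOfRecord₁₀ F N θ.toStage9Params p j, h⟩⟩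

/-- `TLaw₁₁` IS the 𝐓-image form of the pre-𝐑 slot family (`holds_tdensOfRecord₁₀`). [cite: Balaban1988Convergent, remark p.262, (3.25) p.270] -/
theorem tLaw₁₁_iff (θ : Stage11Params F N) (p : B12.RunParams) (k : ℕ) :
    TLaw₁₁ F N θ p k ↔ HasSect2FormTAE F N (FluctV N) p.K (settingOfRecord₁₁ F N θ p) (θ.Rz p.K) (θ.Wt p.K) k
      (UbgOfRecord₁₁ F N θ p (k + 1))
      (slotsTOfRecord F N θ.ν θ.τ9 (EOfRecord₁₀ F N θ.toStage9Params) (wOfRecord₉ F N θ.toStage9Params) θ.ppSel p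
        (gOfRecord₁₀ F N θ.toStage9Params p) (k + 1)) :=
  ⟨fun h => h.2, fun h => ⟨holds_tdensOfRecord₁₀ F N θ.toStage9Params p k, h⟩⟩

/-- **THE 𝐑-CARRIERS OF THE RUN `p`, PINNED ALONG THE REPRESENTED TOWER WITH THE §2 FORMAT OF RECORD**: as `VOfRecord₁₀` (lattice `F.P p.K`, group `SU(N)`,
`K := p.K`, `R k := 𝐓ρ_k ↦ ρ_{k+1}` induced), with target space `S j ρ :↔ ρ = ρ_j ∧ SLaw₁₁ θ p j` and corresponding space `Scorr (k+1) ρ' :↔ ρ' = 𝐓ρ_k ∧ TLaw₁₁ θ p k`,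
`Scorr 0 :≡ ⊥`. [cite: Balaban1988Convergent, p.244 and remark p.262; Balaban1989LargeFieldI, (0.2)–(0.3) p.176] -/
def VOfRecord₁₁ (θ : Stage11Params F N) (p : B12.RunParams) : PrintedCarriers14R where
  P := F.P p.K
  G := SU N
  instGG := inferInstance
  instMS := inferInstance
  instHD := inferInstance
  K := p.K
  R := fun k => inducedAt (tdensOfRecord₁₀ F N θ.toStage9Params p k) (densOfRecord₁₀ F N θ.toStage9Params p (k + 1))
  Scorr := fun j ρ' => match j with
    | 0 => False
    | k + 1 => ρ' = tdensOfRecord₁₀ F N θ.toStage9Params p k ∧ TLaw₁₁ F N θ p k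
  S := fun j ρ => ρ = densOfRecord₁₀ F N θ.toStage9Params p j ∧ SLaw₁₁ F N θ p j

/-- The pinned density operation maps `𝐓ρ_k ↦ ρ_{k+1}`. [cite: Balaban1989LargeFieldI, (0.2)–(0.3) p.176 (bookkeeping)] -/
theorem R_VOfRecord₁₁_tdens (θ : Stage11Params F N) (p : B12.RunParams) (k : ℕ) :
    (VOfRecord₁₁ F N θ p).R k (tdensOfRecord₁₀ F N θ.toStage9Params p k) = densOfRecord₁₀ F N θ.toStage9Params p (k + 1) :=
  inducedAt_self _ _

/-- **[III] p. 244's LEAF AT THE PINNED CARRIERS IS THEOREM 2's SHAPE AT THE OBJECTS OF RECORD**: `ROpLeaf (VOfRecord₁₁ θ p) ↔ ∀ k < K, TLaw₁₁ θ p k → SLaw₁₁ θ p (k+1)`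
— «if `𝐓ρ_k` has the 𝐓-image form then `ρ_{k+1} = 𝐑𝐓ρ_k` has the §2 form at `k+1`». [cite: Balaban1988Convergent, p.244, Thm 2 p.263 and remark p.262 (what the leaf says; bookkeeping)] -/
theorem rOpLeaf_VOfRecord₁₁_iff (θ : Stage11Params F N) (p : B12.RunParams) :
    ROpLeaf (VOfRecord₁₁ F N θ p) ↔ ∀ k, k < p.K → TLaw₁₁ F N θ p k → SLaw₁₁ F N θ p (k + 1) := by
  rw [rOpLeaf_iff]
  refine ⟨fun h k hk hT => ?_, fun h k hk ρ' hρ' => ?_⟩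
  · have hS := h k hk (tdensOfRecord₁₀ F N θ.toStage9Params p k) ⟨rfl, hT⟩
    rw [R_VOfRecord₁₁_tdens] at hS
    exact hS.2
  · obtain ⟨rfl, hT⟩ := hρ'
    show (VOfRecord₁₁ F N θ p).S (k + 1) ((VOfRecord₁₁ F N θ p).R k (tdensOfRecord₁₀ F N θ.toStage9Params p k))
    rw [R_VOfRecord₁₁_tdens]
    exact ⟨rfl, h k hk hT⟩

/-- **THE STAGE-11 RESIDUAL**: the Stage-10 residual with the 𝐑-carriers `V := VOfRecord₁₁ θ` AND THE FORMAT SLOT `S218 := S218OfRecord₁₁ θ` PINNED; every other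
field inherited (`βfun = betaOfRecord₁₀`, `χ = chiFixed7`, the action side over `TcOfRecord`, `R`, `dom`, `wilsonBG`, `E`). [cite: Balaban1988Convergent, p.244, (2.18) p.257; Balaban1989LargeFieldI, (0.2)–(0.6) pp.176–177 (dictionary; bookkeeping)] -/
def residualOfStage11 (θ : Stage11Params F N) : Residual₅ F N :=
  { residualOfStage10 F N θ.toStage9Params with
    V := VOfRecord₁₁ F N θ
    S218 := S218OfRecord₁₁ F N θ }

/-- **The Stage-5 VIEW of Stage-11 parameters** (what the record's upstream block is bound over): `θ`'s Stage-3 dictionary and `γ`, residual := `residualOfStage11 θ`.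
[cite: Balaban1989LargeFieldII, Thm 1 p.355 (bookkeeping)] -/
def Stage11Params.toStage5₁₁ (θ : Stage11Params F N) : Stage5Params F N :=
  { θ.toStage5Params with res := residualOfStage11 F N θ }

/-- The view's 𝐑-carriers ARE the pinned ones (`rfl`). [cite: Balaban1988Convergent, p.244 (bookkeeping)] -/
theorem Stage11Params.toStage5₁₁_res_V (θ : Stage11Params F N) (p : B12.RunParams) : (θ.toStage5₁₁ F N).res.V p = VOfRecord₁₁ F N θ p := rfl

/-- The view's format slot IS the §2 predicate of record (`rfl`). [cite: Balaban1988Convergent, (2.18) p.257 (bookkeeping)] -/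
theorem Stage11Params.toStage5₁₁_res_S218 (θ : Stage11Params F N) : (θ.toStage5₁₁ F N).res.S218 = S218OfRecord₁₁ F N θ := rfl

/-- **THE RECORD'S 𝐑-LEAF, UNFOLDED**: at the C-binding of record over the Stage-11 view, the run's `rOperation` leaf IS «𝐓-image form ⇒ §2 form one level up» along
the tower of record. [cite: Balaban1988Convergent, p.244 and Thm 2 p.263; Balaban1989LargeFieldII, Thm 1 p.355 (bookkeeping)] -/
theorem rOperation_upOfRecord₅C_stage11_iff (θ : Stage11Params F N) (p : B12.RunParams) :
    (upOfRecord₅C F N (θ.toStage5₁₁ F N) p).rOperation ↔ ∀ k, k < p.K → TLaw₁₁ F N θ p k → SLaw₁₁ F N θ p (k + 1) := by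
  show ROpLeaf (VOfRecord₁₁ F N θ p) ↔ _
  exact rOpLeaf_VOfRecord₁₁_iff F N θ p

/-- **THE CORE OF RECORD at `θ`**: the Stage-10 core of the Stage-9 part with the §2 [III] clause PINNED — `Sect2Form p k := S218OfRecord₁₁ θ p k ρ_k` read at the
represented density `densOfRecord₁₀`. [cite: Balaban1987RG1, (0.17)–(0.24) pp.255–257; Balaban1988Convergent, (2.17)–(2.18) p.257, Thm 1 p.262 (dictionary; bookkeeping)] -/
def coreOfRecord₁₁ (θ : Stage11Params F N) : RGMachineCore F (SU N) :=
  { coreOfRecord₁₀ F N θ.toStage9Params with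
    Sect2Form := fun p k => S218OfRecord₁₁ F N θ p k (densOfRecord₁₀ F N θ.toStage9Params p k) }

/-- The core's Wilson start IS `ρ₀` of record. [cite: Balaban1988Convergent, Thm 1 p.262 (bookkeeping)] -/
theorem rhoZero_coreOfRecord₁₁ (θ : Stage11Params F N) (p : B12.RunParams) :
    (coreOfRecord₁₁ F N θ).rhoZero p = densOfRecord₁₀ F N θ.toStage9Params p 0 :=
  rhoZero_coreOfRecord₁₀ F N θ.toStage9Params p

/-- The core's §2 clause IS `SLaw₁₁` (`Iff.rfl`), hence the §2 form of the slots of `ρ_k` (`sLaw₁₁_iff`). [cite: Balaban1988Convergent, (2.18) p.257, Thm 1 p.262 (bookkeeping)] -/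
theorem sect2Form_coreOfRecord₁₁_iff (θ : Stage11Params F N) (p : B12.RunParams) (k : ℕ) :
    (coreOfRecord₁₁ F N θ).Sect2Form p k ↔ SLaw₁₁ F N θ p k := Iff.rfl

/-! ## §5. The displayed provisos of the Stage-11 record -/

/-- **THE DISPLAYED PROVISOS at `θ : Stage11Params`** — HYPOTHESES a record certifies, never asserted: `base` — the Stage-10 provisos of the Stage-9 part VERBATIM
(`intPiece`, `measω`, `measChi`, `zetaUnity`, `zetaAbs`, `rstep`, `contT`); `rzLaws` — 11c's laws of the residual §2 data per torus (unit ↦ unit∕zero: the spaces of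
record are provably non-empty); `wtLaws` — 11a's weight laws (`ζ ≥ 0`, `0 ≤ χ ≤ 1`); `alphaPos` — the radii `α_{0,j}(g_j), α_{1,j}(g_j)` of (2.28) are positive along
every generated history; `bg` — p. 259: «the inductive assumptions (2.7) imply U_k ∈ U^c_j(X, α_{0,j}, α_{1,j})», as 11c's `BgProviso` for def-R's background
maps of record `UbgOfRecord₁₁` ON def-R's REGULAR RETAINED CONFIGURATIONS `suppOfRecord₁₁` (p. 256), at every run and every length `n ≤ K` (print-true by [15]
Thm 1 and (2.7) within the solvability radius; off the solvable domain the map is the unit configuration, which lies in the spaces by `one_mem_spaceI_stage11`;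
here DISPLAYED). [cite: Balaban1988Convergent, (2.7) p.255, (2.21) p.258, (2.28) p.259, (2.35) p.261; Balaban1987RG1, (1.15) p.262; Balaban1989LargeFieldI, (0.3)–(0.4) p.176] -/
structure Stage11Params.Provisos₁₁ (θ : Stage11Params F N) : Prop where
  /-- the Stage-10 provisos of the Stage-9 part, verbatim -/
  base : θ.toStage9Params.Provisos₁₀
  /-- 11c's laws of the residual §2 data: unit configuration ↦ unit ∕ zero -/
  rzLaws : ∀ K, (θ.Rz K).Laws
  /-- 11a's laws of the 𝐓-weights -/
  wtLaws : ∀ K, (θ.Wt K).Laws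
  /-- the radii `α_{0,j}, α_{1,j}` of (2.28) are positive along every generated history -/
  alphaPos : ∀ (p : B12.RunParams) (n : ℕ), 0 < (lfOfRecord₁₁ F N θ).alpha0 (gOfRecord₁₀ F N θ.toStage9Params p n) ∧
    0 < (lfOfRecord₁₁ F N θ).alpha1 (gOfRecord₁₀ F N θ.toStage9Params p n)
  /-- p. 259: def-R's background of record lies in the spaces of record on the regular retained configurations, every run, every length `n ≤ K` -/
  bg : ∀ (p : B12.RunParams) (n : ℕ), n ≤ p.K →
    BgProviso F N p.K (settingOfRecord₁₁ F N θ p) (θ.Rz p.K) θ.τ9.M n (suppOfRecord₁₁ F N θ p n)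
      (UbgOfRecord₁₁ F N θ p n)

variable {F N}

/-- The adapter's support-form provisos at the Stage-11 core FROM the provisos (the core's `E`, `βfun` are the Stage-10 ones; `Record10`'s proof verbatim).
[cite: Balaban1989LargeFieldI, (0.3)–(0.4) p.176 (bookkeeping)] -/
theorem Stage11Params.Provisos₁₁.genTowerProvisosSupp {θ : Stage11Params F N} (h : θ.Provisos₁₁) :
    GenTowerProvisosSupp F N θ.ν θ.τ9 (coreOfRecord₁₁ F N θ) (wOfRecord₉ F N θ.toStage9Params) θ.ppSel where
  tstep := fun p k hk => h.base.tstep p k hk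
  rstep := fun p k _ hk => by convert h.base.rstep p k hk <;> rfl

/-- … and along the histories `gOfRecord₁₀`. [cite: Balaban1989LargeFieldI, (0.3)–(0.4) p.176 (bookkeeping)] -/
theorem Stage11Params.Provisos₁₁.towerProvisosSupp {θ : Stage11Params F N} (h : θ.Provisos₁₁) :
    TowerProvisosSupp F N θ.ν θ.τ9 (coreOfRecord₁₁ F N θ) (wOfRecord₉ F N θ.toStage9Params) θ.ppSel (gOfRecord₁₀ F N θ.toStage9Params) :=
  h.genTowerProvisosSupp.towerProvisosSupp

/-- The Stage-11 provisos carry the β-version proviso of Stage 10. [cite: Balaban1987RG1, (0.13) p.254 (bookkeeping)] -/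
theorem Stage11Params.Provisos₁₁.hasContTransportAlong {θ : Stage11Params F N} (h : θ.Provisos₁₁) : θ.toStage8Params.HasContTransportAlong :=
  h.base.contT

/-- **NON-VACUITY OF THE SPACES OF RECORD AT THE RECORD**: under the provisos and admissibility, the vacuum background `U = 1` lies in `U^c_j(X, α_{0,j}, α_{1,j})`
of record at every run, scale and domain (11c's `one_mem_spaceI`). [cite: Balaban1987RG1, (1.11)–(1.16) p.262] -/
theorem one_mem_spaceI_stage11 {θ : Stage11Params F N} (h : θ.Provisos₁₁) (hθ : θ.Admissible) (p : B12.RunParams) (j : ℕ) (Y : Set (Site (F.P p.K) 0)) :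
    Sect2.ofBackgroundC (ιSU N) (1 : GaugeField (F.P p.K) 0 (SU N)) ∈
      Sect2.spaceI (settingOfRecord₁₁ F N θ p) (θ.Rz p.K) θ.τ9.M j Y ((lfOfRecord₁₁ F N θ).alpha0 (gOfRecord₁₀ F N θ.toStage9Params p j))
        ((lfOfRecord₁₁ F N θ).alpha1 (gOfRecord₁₀ F N θ.toStage9Params p j)) :=
  Sect2.one_mem_spaceI (settingOfRecord₁₁ F N θ p) hθ.pos.1 (h.rzLaws p.K) θ.τ9.M j Y (h.alphaPos p j).1 (h.alphaPos p j).2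

/-- … and in `Ũ^c_j(X, α̃₀, α̃₁)` of record along the sequence's large-field regions (11c's `one_mem_spaceMS`). [cite: Balaban1988Convergent, (2.34)–(2.39) p.261] -/
theorem one_mem_spaceMS_stage11 {θ : Stage11Params F N} (h : θ.Provisos₁₁) (hθ : θ.Admissible) (p : B12.RunParams) (j : ℕ) (Y : Set (Site (F.P p.K) 0))
    (Ω : ℕ → Set (Site (F.P p.K) 0)) :
    Sect2.ofBackgroundC (ιSU N) (1 : GaugeField (F.P p.K) 0 (SU N)) ∈ Sect2.spaceMS (settingOfRecord₁₁ F N θ p) (θ.Rz p.K) θ.τ9.M j Y Ω :=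
  Sect2.one_mem_spaceMS (settingOfRecord₁₁ F N θ p) (settingOfRecord₁₁_pos F N θ hθ.pos p) (h.rzLaws p.K) θ.τ9.M j Y Ω
    (fun n => (h.alphaPos p n).1) (fun n => (h.alphaPos p n).2)

/-- **THE (2.27)(iv) BOUND BITES AT THE BACKGROUND OF RECORD**: under the provisos, whenever `ρ_k` of the run has the §2 form of record (`SLaw₁₁`), its witnessing
𝐄-terms obey `|𝐄^{(j)}(X, U_k(s)(𝐖), z)| ≤ E₀ exp(−κ d_j(X))` POINTWISE at every regular retained configuration `𝐖` (`HasSect2FormAE.norm_E_bg_le` with `bg`;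
the version reading touches only the slot identity, never the term bounds). [cite: Balaban1988Convergent, (2.23) p.258, (2.27)(iv)–(2.28) p.259] -/
theorem norm_E_bg_le_stage11 {θ : Stage11Params F N} (h : θ.Provisos₁₁) (p : B12.RunParams) (k : ℕ) (hk : k ≤ p.K) (hS : SLaw₁₁ F N θ p k) :
    ∃ t : SeqOfRecord F θ.ν θ.τ9.M (gOfRecord₁₀ F N θ.toStage9Params p) p.K k → Sect2.TermValues (F.P p.K) (MatA N) (FluctV N) θ.τ9.M,
      Sect2.UniversalE t ∧ ∀ s Wc, Wc ∈ suppOfRecord₁₁ F N θ p k s → ∀ j, 1 ≤ j → j ≤ k →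
        ∀ (X : (Sect2.domSys (F.P p.K) θ.τ9.M j).Dom) (z : Site (F.P p.K) j) (g' : ℝ), 0 ≤ g' → g' ≤ (lfOfRecord₁₁ F N θ).γ →
          ‖(t s).E j X z g' (Sect2.ofBackgroundC (ιSU N) (UbgOfRecord₁₁ F N θ p k s Wc))‖ ≤
            (lfOfRecord₁₁ F N θ).E₀ * Real.exp (-(lfOfRecord₁₁ F N θ).κ * (Sect2.domSys (F.P p.K) θ.τ9.M j).dj X) :=
  ((sLaw₁₁_iff F N θ p k).mp hS).norm_E_bg_le (h.bg p k hk)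

variable (F N)

/-! ## §6. The tower and the datum of record; faces -/

/-- **THE TOWER OF RECORD at `θ` under its provisos** (the support-form adapter at the Stage-11 core): `ρ p k = densOfRecord₁₀ θ' p k`, `Trho p k = tdensOfRecord₁₀ θ' p k`.
[cite: Balaban1988Convergent, (0.2) p.244, (2.18) p.257, (3.25) p.270; Balaban1989LargeFieldI, (0.4) p.176] -/
def towerOfRecord₁₁ (θ : Stage11Params F N) (h : θ.Provisos₁₁) : (coreOfRecord₁₁ F N θ).Tower (avOfRecord F N) :=
  towerOfRecord9GenSupp h.genTowerProvisosSupp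

/-- **THE DATUM OF RECORD, STAGE 11**: the tower-form assembler at the Stage-11 core and tower. [cite: Balaban1989LargeFieldII, Thm 1 + (0.1) pp.355–356; Balaban1988Convergent, (0.2) p.244] -/
def datumOfRecord₁₁ (θ : Stage11Params F N) (h : θ.Provisos₁₁) : FiniteEpsData F (SU N) :=
  datumOfTower F N (coreOfRecord₁₁ F N θ) (towerOfRecord₁₁ F N θ h)

/-- The tower's densities ARE `densOfRecord₁₀` of the Stage-9 part (`rfl`). [cite: Balaban1988Convergent, (2.18) p.257 (bookkeeping)] -/
theorem towerOfRecord₁₁_ρ (θ : Stage11Params F N) (h : θ.Provisos₁₁) (p : B12.RunParams) (k : ℕ) :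
    (towerOfRecord₁₁ F N θ h).ρ p k = densOfRecord₁₀ F N θ.toStage9Params p k := rfl

/-- The tower's `𝐓ρ_k` ARE `tdensOfRecord₁₀` (`rfl`). [cite: Balaban1988Convergent, (3.25) p.270 (bookkeeping)] -/
theorem towerOfRecord₁₁_Trho (θ : Stage11Params F N) (h : θ.Provisos₁₁) (p : B12.RunParams) (k : ℕ) :
    (towerOfRecord₁₁ F N θ h).Trho p k = tdensOfRecord₁₀ F N θ.toStage9Params p k := rfl

/-- The tower of record is integrable (every `ρ_k`, `k ≤ K`). [cite: Balaban1988Convergent, (0.2) p.244 (bookkeeping)] -/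
theorem isIntegrable_towerOfRecord₁₁ (θ : Stage11Params F N) (h : θ.Provisos₁₁) : (towerOfRecord₁₁ F N θ h).IsIntegrable :=
  isIntegrable_towerOfRecord9GenSupp h.genTowerProvisosSupp

/-- FACE `dens`: the datum's densities ARE `densOfRecord₁₀` at the run `(K, F.m, g₀)` (`rfl`). [cite: Balaban1988Convergent, (2.18) p.257 (bookkeeping)] -/
theorem dens_datumOfRecord₁₁ (θ : Stage11Params F N) (h : θ.Provisos₁₁) (K : ℕ) (g₀ : ℝ) (k : ℕ) :
    (datumOfRecord₁₁ F N θ h).dens K g₀ k = densOfRecord₁₀ F N θ.toStage9Params ⟨K, F.m, g₀⟩ k := rfl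

/-- FACE `Trho`: the datum's realised `𝐓ρ_k` ARE `tdensOfRecord₁₀` (`rfl`). [cite: Balaban1988Convergent, (3.25) p.270 (bookkeeping)] -/
theorem trho_datumOfRecord₁₁ (θ : Stage11Params F N) (h : θ.Provisos₁₁) (K : ℕ) (g₀ : ℝ) (k : ℕ) :
    (datumOfRecord₁₁ F N θ h).real.Trho K g₀ k = tdensOfRecord₁₀ F N θ.toStage9Params ⟨K, F.m, g₀⟩ k := rfl

/-- FACE `𝐑`: the datum's large-field operation IS the pinned carriers' density operation (`rfl`). [cite: Balaban1989LargeFieldI, (0.2)–(0.3) p.176 (bookkeeping)] -/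
theorem R_datumOfRecord₁₁_eq_VOfRecord₁₁ (θ : Stage11Params F N) (h : θ.Provisos₁₁) (K : ℕ) (g₀ : ℝ) (k : ℕ) :
    (datumOfRecord₁₁ F N θ h).real.R K g₀ k = (VOfRecord₁₁ F N θ ⟨K, F.m, g₀⟩).R k := rfl

/-- … and maps `𝐓ρ_k ↦ ρ_{k+1}`. [cite: Balaban1988Convergent, (0.2) p.244; Balaban1989LargeFieldI, (0.3) p.176] -/
theorem R_tdens_datumOfRecord₁₁ (θ : Stage11Params F N) (h : θ.Provisos₁₁) (K : ℕ) (g₀ : ℝ) (k : ℕ) :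
    (datumOfRecord₁₁ F N θ h).real.R K g₀ k (tdensOfRecord₁₀ F N θ.toStage9Params ⟨K, F.m, g₀⟩ k) =
      densOfRecord₁₀ F N θ.toStage9Params ⟨K, F.m, g₀⟩ (k + 1) :=
  (towerOfRecord₁₁ F N θ h).inducedR_Trho ⟨K, F.m, g₀⟩ k

/-- FACE construction: the datum's `C` is the Stage-11 core's construction over the densities of record (`rfl`). [cite: Balaban1989LargeFieldII, Thm 1 + (0.1) pp.355–356 (bookkeeping)] -/
theorem datumOfRecord₁₁_C (θ : Stage11Params F N) (h : θ.Provisos₁₁) :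
    (datumOfRecord₁₁ F N θ h).C = (coreOfRecord₁₁ F N θ).construction (densOfRecord₁₀ F N θ.toStage9Params) := rfl

/-- FACE β: the datum's β-functions ARE `betaOfRecord₁₀` of the Stage-9 part (`= betaOfRecord₉c`, `rfl`). [cite: Balaban1987RG1, (1.20)–(1.22) p.264 (bookkeeping)] -/
theorem βfun_datumOfRecord₁₁ (θ : Stage11Params F N) (h : θ.Provisos₁₁) : (datumOfRecord₁₁ F N θ h).βfun = betaOfRecord₁₀ F N θ.toStage9Params := rfl

/-- FACE flow: every run's flow is generated forward by (0.20) with the β of record; its couplings ARE `gOfRecord₁₀` (`rfl`). [cite: Balaban1987RG1, (0.17)–(0.20) pp.255–256 (bookkeeping)] -/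
theorem flow_g_datumOfRecord₁₁ (θ : Stage11Params F N) (h : θ.Provisos₁₁) (p : B12.RunParams) :
    ((datumOfRecord₁₁ F N θ h).C p).flow.g = gOfRecord₁₀ F N θ.toStage9Params p := rfl

/-- FACE av: the averaging maps are the averaging operations of record (`rfl`). [cite: Balaban1987RG1, (0.4) p.253 (bookkeeping)] -/
theorem av_datumOfRecord₁₁ (θ : Stage11Params F N) (h : θ.Provisos₁₁) : (datumOfRecord₁₁ F N θ h).av = avOfRecord F N := rfl

/-- STAGE-0 DATUM CLAUSE at the Stage-11 datum (`rfl`). [cite: Balaban1987RG1, (0.3)–(0.4) p.253] -/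
theorem isDatumOfRecord₀_datumOfRecord₁₁ (θ : Stage11Params F N) (h : θ.Provisos₁₁) : IsDatumOfRecord₀ F N (datumOfRecord₁₁ F N θ h) := rfl

/-- BINDER B1 = NODE N23 at the Stage-11 datum. [cite: Balaban1987RG1, (0.4) p.253] -/
theorem isPrintedAveraged_datumOfRecord₁₁ (θ : Stage11Params F N) (h : θ.Provisos₁₁) : (datumOfRecord₁₁ F N θ h).IsPrintedAveraged :=
  isPrintedAveraged_datumOfTower F N _ _

/-- FACE χ ∕ actions ∕ `IndAss` ∕ `Repr`: the Stage-10 fields VERBATIM at the Stage-9 part (`rfl`; quoted through `coreOfRecord₁₀`). [cite: Balaban1987RG1, (0.17)–(0.24) pp.255–257 (bookkeeping)] -/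
theorem actionSide_stage11 (θ : Stage11Params F N) (h : θ.Provisos₁₁) (p : B12.RunParams) (k : ℕ) :
    ((datumOfRecord₁₁ F N θ h).C p).χ k = (coreOfRecord₁₀ F N θ.toStage9Params).χ p k ∧
      ((datumOfRecord₁₁ F N θ h).C p).effAction k = (coreOfRecord₁₀ F N θ.toStage9Params).effAction p k ∧
        ((datumOfRecord₁₁ F N θ h).C p).Ek k = (coreOfRecord₁₀ F N θ.toStage9Params).Ek p k ∧
          (((datumOfRecord₁₁ F N θ h).C p).IndAss k ↔ (coreOfRecord₁₀ F N θ.toStage9Params).IndAss p k) ∧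
            (((datumOfRecord₁₁ F N θ h).C p).Repr k ↔ (coreOfRecord₁₀ F N θ.toStage9Params).Repr p k) :=
  ⟨rfl, rfl, rfl, Iff.rfl, Iff.rfl⟩

/-- **FACE `Sect2Form` — THE PIN**: the construction's §2 [III] clause at step `k` IS the §2 FORM OF RECORD (a.e. reading) of the post-𝐑 slot family of `ρ_k`
(`HasSect2FormAE` at the setting, residual data and weights of `θ` and def-R's background maps of record). [cite: Balaban1988Convergent, (2.18) p.257, (2.23)–(2.42) pp.258–261, Thm 1 p.262] -/
theorem sect2Form_stage11_iff (θ : Stage11Params F N) (h : θ.Provisos₁₁) (p : B12.RunParams) (k : ℕ) :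
    ((datumOfRecord₁₁ F N θ h).C p).Sect2Form k ↔
      HasSect2FormAE F N (FluctV N) p.K (settingOfRecord₁₁ F N θ p) (θ.Rz p.K) (θ.Wt p.K) k
        (UbgOfRecord₁₁ F N θ p k)
        (slotsOfRecord F N θ.ν θ.τ9 (EOfRecord₁₀ F N θ.toStage9Params) (wOfRecord₉ F N θ.toStage9Params) θ.ppSel p
          (gOfRecord₁₀ F N θ.toStage9Params p) k) :=
  sLaw₁₁_iff F N θ p k

/-- (2.18) holds for the datum's densities with `rep_k` of record, by construction. [cite: Balaban1988Convergent, (2.18) p.257] -/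
theorem holds_dens_datumOfRecord₁₁ (θ : Stage11Params F N) (h : θ.Provisos₁₁) (K : ℕ) (g₀ : ℝ) (k : ℕ) :
    (reprOfRecord₁₀ F N θ.toStage9Params ⟨K, F.m, g₀⟩ k).Holds ((datumOfRecord₁₁ F N θ h).dens K g₀ k) :=
  holds_densOfRecord₁₀ F N θ.toStage9Params _ k

/-- FACE Wilson start: `ρ₀ = e^{−E}·exp(−A∕g₀²)`. [cite: Balaban1988Convergent, Thm 1 p.262] -/
theorem dens_zero_datumOfRecord₁₁ (θ : Stage11Params F N) (h : θ.Provisos₁₁) (K : ℕ) (g₀ : ℝ) :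
    (datumOfRecord₁₁ F N θ h).dens K g₀ 0 = rhoZeroOfRecord F N K g₀ (EOfRecord₁₀ F N θ.toStage9Params ⟨K, F.m, g₀⟩) :=
  densOfRecord₁₀_zero F N θ.toStage9Params ⟨K, F.m, g₀⟩

/-- FACE push-forward: `𝐓ρ_k` IS an averaging-of-record image of `ρ_k` (`k < K`). [cite: Balaban1988Convergent, (3.1) p.264, (3.24)–(3.25) p.270] -/
theorem isRT_trho_datumOfRecord₁₁ (θ : Stage11Params F N) (h : θ.Provisos₁₁) (K : ℕ) (g₀ : ℝ) (k : ℕ) (hk : k < K) :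
    IsRT (avOfRecord F N K k).avg ((datumOfRecord₁₁ F N θ h).dens K g₀ k) ((datumOfRecord₁₁ F N θ h).real.Trho K g₀ k) :=
  (towerOfRecord₁₁ F N θ h).isRT_Trho ⟨K, F.m, g₀⟩ k hk

/-- FACE (0.4) at the step: `∫ρ_{k+1} = ∫𝐓ρ_k` (`k < K`). [cite: Balaban1989LargeFieldI, (0.4) p.176] -/
theorem integral_dens_succ_datumOfRecord₁₁ (θ : Stage11Params F N) (h : θ.Provisos₁₁) (K : ℕ) (g₀ : ℝ) (k : ℕ) (hk : k < K) :
    ∫ V, (datumOfRecord₁₁ F N θ h).dens K g₀ (k + 1) V ∂fieldMeasure (F.P K) (k + 1) (SU N)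
      = ∫ V, (datumOfRecord₁₁ F N θ h).real.Trho K g₀ k V ∂fieldMeasure (F.P K) (k + 1) (SU N) :=
  (towerOfRecord₁₁ F N θ h).integral_succ ⟨K, F.m, g₀⟩ k hk

/-- `∫ρ_k = ∫ρ₀` along every run, `k ≤ K`. [cite: Balaban1985UV3, (6) p.257] -/
theorem integral_dens_eq_zero_datumOfRecord₁₁ (θ : Stage11Params F N) (h : θ.Provisos₁₁) (K : ℕ) (g₀ : ℝ) (k : ℕ) (hk : k ≤ K) :
    ∫ V, (datumOfRecord₁₁ F N θ h).dens K g₀ k V ∂fieldMeasure (F.P K) k (SU N)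
      = ∫ U, (datumOfRecord₁₁ F N θ h).dens K g₀ 0 U ∂fieldMeasure (F.P K) 0 (SU N) :=
  (towerOfRecord₁₁ F N θ h).integral_eq_integral_zero ⟨K, F.m, g₀⟩ k hk

/-- FACE integrability: every density of the datum, `k ≤ K`, is integrable. [cite: Balaban1988Convergent, (0.2) p.244 (bookkeeping)] -/
theorem integrable_dens_datumOfRecord₁₁ (θ : Stage11Params F N) (h : θ.Provisos₁₁) (K : ℕ) (g₀ : ℝ) (k : ℕ) (hk : k ≤ K) :
    Integrable ((datumOfRecord₁₁ F N θ h).dens K g₀ k) (fieldMeasure (F.P K) k (SU N)) :=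
  isIntegrable_towerOfRecord₁₁ F N θ h ⟨K, F.m, g₀⟩ k hk

/-- … and so is every realised `𝐓ρ_k`, `k < K`. [cite: Balaban1988Convergent, (3.25) p.270 (bookkeeping)] -/
theorem integrable_trho_datumOfRecord₁₁ (θ : Stage11Params F N) (h : θ.Provisos₁₁) (K : ℕ) (g₀ : ℝ) (k : ℕ) (hk : k < K) :
    Integrable ((datumOfRecord₁₁ F N θ h).real.Trho K g₀ k) (fieldMeasure (F.P K) (k + 1) (SU N)) :=
  integrable_towerOfRecord9Supp_Trho h.towerProvisosSupp ⟨K, F.m, g₀⟩ k hk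

/-- The T⁴ apex at the Stage-11 datum, B1 eliminated. [cite: JaffeWittenClay2006, §6.5 p.11] -/
theorem continuumYM4Torus_datumOfRecord₁₁ (θ : Stage11Params F N) (h : θ.Provisos₁₁)
    (hB : B16.EndStatementBPrinted (datumOfRecord₁₁ F N θ h).C)
    (hE : EndpointExistence (datumOfRecord₁₁ F N θ h).C.toB12)
    (hNE : T4ApexHybrid.HybridNE7Under (datumOfRecord₁₁ F N θ h) (EndpointExistence (datumOfRecord₁₁ F N θ h).C.toB12)) :
    T4ContinuumYM4Torus.ContinuumYM4Torus (datumOfRecord₁₁ F N θ h) :=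
  continuumYM4Torus_datumOfTower F N _ _ hB hE hNE

/-! ## §7. The Stage-11 record predicate (C-binding) -/

/-- **«(D, w) is the record, Stage 11»**: admissible Stage-11 parameters SATISFYING THEIR DISPLAYED PROVISOS whose datum of record IS `D`, and a world bound to its
construction with a window `0 < w.γ ≤ θ.γ`, Bałaban's block size and the C-binding of record over the Stage-11 view (whose 𝐑-leaf carries the §2 format of record).
[cite: Balaban1989LargeFieldII, Thm 1 + (0.1) pp.355–356; Balaban1988Convergent, (0.2) p.244, (2.18) p.257, Thms 1–2 pp.262–263; Balaban1989LargeFieldI, (0.2)–(0.4) p.176 (objects of record; bookkeeping)] -/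
def IsRecordOfRecord₁₁C (D : FiniteEpsData F (SU N)) (w : WorldP) : Prop :=
  ∃ (θ : Stage11Params F N) (h : θ.Provisos₁₁), θ.Admissible ∧ D = datumOfRecord₁₁ F N θ h ∧ w.C = D.C ∧ (0 < w.γ ∧ w.γ ≤ θ.γ) ∧
    w.L = (θ.L : ℝ) ∧ ∀ P : B12.RunParams, w.up P = upOfRecord₅C F N (θ.toStage5₁₁ F N) P

/-- **Pointed form**. [cite: Balaban1989LargeFieldII, Thm 1 + (0.1) pp.355–356 (bookkeeping)] -/
theorem isRecordOfRecord₁₁C_of_eq (θ : Stage11Params F N) (h : θ.Provisos₁₁) (hθ : θ.Admissible) (w : WorldP)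
    (hC : w.C = (datumOfRecord₁₁ F N θ h).C) (hγ : 0 < w.γ ∧ w.γ ≤ θ.γ) (hL : w.L = (θ.L : ℝ))
    (hup : ∀ P, w.up P = upOfRecord₅C F N (θ.toStage5₁₁ F N) P) :
    IsRecordOfRecord₁₁C F N (datumOfRecord₁₁ F N θ h) w :=
  ⟨θ, h, hθ, rfl, hC, hγ, hL, hup⟩

/-- **Every admissible Stage-11 parameter satisfying its provisos IS a Stage-11 record at some world**, with any window `0 < γw ≤ θ.γ` — inhabitation of the record
class is EXACTLY «some admissible θ satisfies the displayed provisos». [cite: Balaban1989LargeFieldII, Thm 1 + (0.1) pp.355–356 (bookkeeping)] -/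
theorem exists_world_isRecordOfRecord₁₁C (θ : Stage11Params F N) (h : θ.Provisos₁₁) (hθ : θ.Admissible) {γw : ℝ} (hγw : 0 < γw ∧ γw ≤ θ.γ) :
    ∃ w : WorldP, IsRecordOfRecord₁₁C F N (datumOfRecord₁₁ F N θ h) w ∧ w.γ = γw := by
  obtain ⟨w₀⟩ := nonempty_worldP
  exact ⟨{ w₀ with
      C := (datumOfRecord₁₁ F N θ h).C, γ := γw, L := (θ.L : ℝ), one_lt_L := by exact_mod_cast θ.hL.2,
      up := fun P => upOfRecord₅C F N (θ.toStage5₁₁ F N) P },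
    ⟨θ, h, hθ, rfl, rfl, hγw, rfl, fun _ => rfl⟩, rfl⟩

section Consequences

variable {F N}
variable {D : FiniteEpsData F (SU N)} {w : WorldP}

/-- A Stage-11 record CERTIFIES its parameters' provisos and admissibility. [cite: Balaban1989LargeFieldI, (0.3)–(0.4) p.176 (bookkeeping)] -/
theorem exists_provisos_of_isRecordOfRecord₁₁C (h : IsRecordOfRecord₁₁C F N D w) :
    ∃ (θ : Stage11Params F N) (hP : θ.Provisos₁₁), θ.Admissible ∧ D = datumOfRecord₁₁ F N θ hP := by
  obtain ⟨θ, hP, hθ, hD, -⟩ := h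
  exact ⟨θ, hP, hθ, hD⟩

/-- Binding clause 1: the world's construction IS the datum's. [cite: Balaban1989LargeFieldII, Thm 1 p.355 (bookkeeping)] -/
theorem construction_eq_of_isRecordOfRecord₁₁C (h : IsRecordOfRecord₁₁C F N D w) : w.C = D.C := by
  obtain ⟨θ, hP, -, -, hC, -⟩ := h
  exact hC

/-- Binding clause 2: the interval constant is positive. [cite: Balaban1989LargeFieldII, Thm 1 p.355 (bookkeeping)] -/
theorem gamma_pos_of_isRecordOfRecord₁₁C (h : IsRecordOfRecord₁₁C F N D w) : 0 < w.γ := by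
  obtain ⟨θ, hP, -, -, -, hγ, -⟩ := h
  exact hγ.1

/-- A Stage-11 record's datum is a datum of record, Stage 0. [cite: Balaban1987RG1, (0.3)–(0.4) p.253 (bookkeeping)] -/
theorem isDatumOfRecord₀_of_isRecordOfRecord₁₁C (h : IsRecordOfRecord₁₁C F N D w) : IsDatumOfRecord₀ F N D := by
  obtain ⟨θ, hP, -, rfl, -⟩ := h
  exact isDatumOfRecord₀_datumOfRecord₁₁ F N θ hP

/-- N23 · binder B1 at every Stage-11 record. [cite: Balaban1987RG1, (0.4) p.253] -/
theorem isPrintedAveraged_of_isRecordOfRecord₁₁C (h : IsRecordOfRecord₁₁C F N D w) : D.IsPrintedAveraged :=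
  isPrintedAveraged_of_isDatumOfRecord₀ F N D (isDatumOfRecord₀_of_isRecordOfRecord₁₁C h)

/-- **A Stage-11 record's 𝐑-leaf IS «𝐓-image form ⇒ §2 form one level up» along its tower of record**, at every run (the junction hypothesis of N11∕N13 at ₁₁,
unfolded; the laws are 11c's `LawsT` ∕ `LawsRT` packages inside `HasSect2FormT` ∕ `HasSect2Form`). [cite: Balaban1988Convergent, p.244, Thm 2 p.263; Balaban1989LargeFieldII, Thm 1 p.355 (bookkeeping)] -/
theorem exists_rOperation_iff_of_isRecordOfRecord₁₁C (h : IsRecordOfRecord₁₁C F N D w) :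
    ∃ (θ : Stage11Params F N) (hP : θ.Provisos₁₁), θ.Admissible ∧ D = datumOfRecord₁₁ F N θ hP ∧
      ∀ P : B12.RunParams, (leavesP w P).rOperation ↔ ∀ k, k < P.K → TLaw₁₁ F N θ P k → SLaw₁₁ F N θ P (k + 1) := by
  obtain ⟨θ, hP, hθ, hD, -, -, -, hup⟩ := h
  refine ⟨θ, hP, hθ, hD, fun P => ?_⟩
  show (w.up P).rOperation ↔ _
  rw [hup P]
  exact rOperation_upOfRecord₅C_stage11_iff F N θ P

/-- **AT A STAGE-11 RECORD WHOSE 𝐑-LEAVES HOLD, EVERY `ρ_{k+1}` WHOSE `𝐓ρ_k` HAS THE 𝐓-IMAGE FORM HAS THE §2 FORM OF RECORD** — the slots of `ρ_{k+1}` are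
`𝐓_{k+1}(s) exp A_{k+1}(s)` a.e. on the χ-support, with law-abiding terms (what the leaf now delivers to N11∕N13's consumers). [cite: Balaban1988Convergent, Thm 2 p.263, (2.18) p.257, (2.23) p.258 (bookkeeping)] -/
theorem hasSect2FormAE_succ_of_isRecordOfRecord₁₁C (h : IsRecordOfRecord₁₁C F N D w) (hR : ∀ P : B12.RunParams, (leavesP w P).rOperation) :
    ∃ (θ : Stage11Params F N) (hP : θ.Provisos₁₁), θ.Admissible ∧ D = datumOfRecord₁₁ F N θ hP ∧
      ∀ (P : B12.RunParams) (k : ℕ), k < P.K → TLaw₁₁ F N θ P k →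
        HasSect2FormAE F N (FluctV N) P.K (settingOfRecord₁₁ F N θ P) (θ.Rz P.K) (θ.Wt P.K) (k + 1)
          (UbgOfRecord₁₁ F N θ P (k + 1))
          (slotsOfRecord F N θ.ν θ.τ9 (EOfRecord₁₀ F N θ.toStage9Params) (wOfRecord₉ F N θ.toStage9Params) θ.ppSel P
            (gOfRecord₁₀ F N θ.toStage9Params P) (k + 1)) := by
  obtain ⟨θ, hP, hθ, hD, hrop⟩ := exists_rOperation_iff_of_isRecordOfRecord₁₁C h
  exact ⟨θ, hP, hθ, hD, fun P k hk hT => (sLaw₁₁_iff F N θ P (k + 1)).mp (((hrop P).mp (hR P)) k hk hT)⟩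

end Consequences

/-! ## §8. The shadow; refinement to the Stage-5 record predicate AT THE SHADOW; transfer of world-reading theorems -/

/-- **THE SHADOW RESIDUAL of `θ` under its provisos**: the Stage-11 residual with `R :=` the density operation induced at the Radon–Nikodym image of the tower of
record and the format slot FROZEN at the density of record (`S218 p k _ := S218OfRecord₁₁ θ p k (densOfRecord₁₀ θ' p k)`).  A PROOF DEVICE for the refinement below —
never an object of record. [cite: Balaban1989LargeFieldI, (0.2)–(0.4) p.176; Balaban1987RG1, (0.13) p.254 (bookkeeping)] -/
def shadowResidual₁₁ (θ : Stage11Params F N) (h : θ.Provisos₁₁) : Residual₅ F N :=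
  { residualOfStage11 F N θ with
    R := fun p k => (towerOfRecord₁₁ F N θ h).shadowR p k
    preservesIntegral_R := fun p k hk => preservesIntegral_shadowR_towerOfRecord9Supp h.towerProvisosSupp p k hk
    integrable_R := fun p k hk => integrable_shadowR_towerOfRecord9Supp h.towerProvisosSupp p k hk
    S218 := fun p k _ => S218OfRecord₁₁ F N θ p k (densOfRecord₁₀ F N θ.toStage9Params p k) }

/-- **THE SHADOW Stage-5 parameters of `θ`** at interval letter `γ'`. [cite: Balaban1989LargeFieldI, (0.2) p.176 (bookkeeping)] -/
def shadow₅OfRecord₁₁ (θ : Stage11Params F N) (h : θ.Provisos₁₁) (γ' : ℝ) : Stage5Params F N :=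
  { θ.toStage5Params with γ := γ', res := shadowResidual₁₁ F N θ h }

/-- THE KEY `rfl`: the machine of the shadow has core `coreOfRecord₁₁ θ`. [cite: Balaban1988Convergent, (0.2) p.244 (bookkeeping)] -/
theorem toCore_machineOfRecord₅_shadow₁₁ (θ : Stage11Params F N) (h : θ.Provisos₁₁) (γ' : ℝ) :
    (machineOfRecord₅ F N (shadow₅OfRecord₁₁ F N θ h γ')).toCore = coreOfRecord₁₁ F N θ := rfl

/-- The shadow's residual `R` IS the tower's shadow operation (`rfl`). [cite: Balaban1989LargeFieldI, (0.3) p.176 (bookkeeping)] -/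
theorem res_R_shadow₁₁ (θ : Stage11Params F N) (h : θ.Provisos₁₁) (γ' : ℝ) (p : B12.RunParams) (k : ℕ) :
    (shadow₅OfRecord₁₁ F N θ h γ').res.R p k = (towerOfRecord₁₁ F N θ h).shadowR p k := rfl

/-- The shadow is Stage-5 admissible iff `θ`'s Stage-1 dictionary is admissible and `0 < γ'`. [cite: Balaban1989LargeFieldII, Thm 1 p.355 (bookkeeping)] -/
theorem admissible_shadow₁₁ (θ : Stage11Params F N) (h : θ.Provisos₁₁) {γ' : ℝ} (hθ : θ.Admissible) (hγ' : 0 < γ') :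
    (shadow₅OfRecord₁₁ F N θ h γ').Admissible :=
  ⟨hθ.1.1.1.1.1, hγ'⟩

/-- The shadow's upstream block IS the Stage-11 view's (`rfl`). [cite: Balaban1985UV3, Thm 1 p.257 (bookkeeping)] -/
theorem upOfRecord₅C_shadow₁₁ (θ : Stage11Params F N) (h : θ.Provisos₁₁) (γ' : ℝ) (P : B12.RunParams) :
    upOfRecord₅C F N (shadow₅OfRecord₁₁ F N θ h γ') P = upOfRecord₅C F N (θ.toStage5₁₁ F N) P := rfl

/-- The shadow datum has the SAME CONSTRUCTION as the Stage-11 datum. [cite: Balaban1989LargeFieldII, Thm 1 + (0.1) pp.355–356 (bookkeeping)] -/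
theorem datumOfRecord₅_shadow₁₁_C (θ : Stage11Params F N) (h : θ.Provisos₁₁) (γ' : ℝ) :
    (datumOfRecord₅ F N (shadow₅OfRecord₁₁ F N θ h γ')).C = (datumOfRecord₁₁ F N θ h).C :=
  datumOfRecord_C_eq_datumOfTower F N (machineOfRecord₅ F N (shadow₅OfRecord₁₁ F N θ h γ')) (towerOfRecord₁₁ F N θ h) (fun _ _ => rfl)

/-- … the same densities. [cite: Balaban1988Convergent, (0.2) p.244 (bookkeeping)] -/
theorem dens_datumOfRecord₅_shadow₁₁ (θ : Stage11Params F N) (h : θ.Provisos₁₁) (γ' : ℝ) (K : ℕ) (g₀ : ℝ) (k : ℕ) :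
    (datumOfRecord₅ F N (shadow₅OfRecord₁₁ F N θ h γ')).dens K g₀ k = (datumOfRecord₁₁ F N θ h).dens K g₀ k :=
  dens_datumOfRecord_eq_datumOfTower F N (machineOfRecord₅ F N (shadow₅OfRecord₁₁ F N θ h γ')) (towerOfRecord₁₁ F N θ h) (fun _ _ => rfl) K g₀ k

/-- … the same β-functions (`rfl`). [cite: Balaban1987RG1, (1.22) p.264 (bookkeeping)] -/
theorem βfun_datumOfRecord₅_shadow₁₁ (θ : Stage11Params F N) (h : θ.Provisos₁₁) (γ' : ℝ) :
    (datumOfRecord₅ F N (shadow₅OfRecord₁₁ F N θ h γ')).βfun = (datumOfRecord₁₁ F N θ h).βfun := rfl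

/-- … and the same averaging maps (`rfl`). [cite: Balaban1987RG1, (0.4) p.253 (bookkeeping)] -/
theorem av_datumOfRecord₅_shadow₁₁ (θ : Stage11Params F N) (h : θ.Provisos₁₁) (γ' : ℝ) :
    (datumOfRecord₅ F N (shadow₅OfRecord₁₁ F N θ h γ')).av = (datumOfRecord₁₁ F N θ h).av := rfl

/-- **A STAGE-11 WORLD IS A STAGE-5 RECORD AT THE SHADOW DATUM** (witness: the shadow at the world's own letter `w.γ`). [cite: Balaban1989LargeFieldII, Thm 1 + (0.1) pp.355–356 (bookkeeping)] -/
theorem isRecordOfRecord₅C_shadow₁₁ (θ : Stage11Params F N) (h : θ.Provisos₁₁) (hθ : θ.Admissible) (w : WorldP)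
    (hC : w.C = (datumOfRecord₁₁ F N θ h).C) (hγ : 0 < w.γ) (hL : w.L = (θ.L : ℝ))
    (hup : ∀ P, w.up P = upOfRecord₅C F N (θ.toStage5₁₁ F N) P) :
    IsRecordOfRecord₅C F N (datumOfRecord₅ F N (shadow₅OfRecord₁₁ F N θ h w.γ)) w :=
  isRecordOfRecord₅C_shadow F N (shadow₅OfRecord₁₁ F N θ h w.γ) (admissible_shadow₁₁ F N θ h hθ hγ) (towerOfRecord₁₁ F N θ h)
    (fun _ _ => rfl) w hC rfl hL hup

variable {F N}

/-- **REFINEMENT `IsRecordOfRecord₁₁C → IsRecordOfRecord₅C` AT THE SHADOW**: every Stage-11 record's world is a Stage-5 record at a datum with THE SAME construction,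
densities, β-functions and averaging maps. [cite: Balaban1989LargeFieldII, Thm 1 + (0.1) pp.355–356 (bookkeeping)] -/
theorem exists_isRecordOfRecord₅C_of_isRecordOfRecord₁₁C {D : FiniteEpsData F (SU N)} {w : WorldP} (h : IsRecordOfRecord₁₁C F N D w) :
    ∃ D₅ : FiniteEpsData F (SU N), IsRecordOfRecord₅C F N D₅ w ∧ D₅.C = D.C ∧ (∀ K g₀ k, D₅.dens K g₀ k = D.dens K g₀ k) ∧
      D₅.βfun = D.βfun ∧ D₅.av = D.av := by
  obtain ⟨θ, hP, hθ, rfl, hC, ⟨hγ0, -⟩, hL, hup⟩ := h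
  exact ⟨_, isRecordOfRecord₅C_shadow₁₁ F N θ hP hθ w hC hγ0 hL hup, datumOfRecord₅_shadow₁₁_C F N θ hP w.γ,
    dens_datumOfRecord₅_shadow₁₁ F N θ hP w.γ, rfl, rfl⟩

/-- **TRANSFER**: every node statement established over the Stage-5 record predicate in the `AtRecord` shape holds at every run of every Stage-11 record's world.
[cite: Balaban1989LargeFieldII, Thm 1 p.355 (bookkeeping)] -/
theorem atWorld_of_isRecordOfRecord₁₁C {X : Dag.Leaves → Prop}
    (h₅ : ∀ (D : FiniteEpsData F (SU N)) (w : WorldP), IsRecordOfRecord₅C F N D w → ∀ P : B12.RunParams, X (leavesP w P))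
    {D : FiniteEpsData F (SU N)} {w : WorldP} (h : IsRecordOfRecord₁₁C F N D w) (P : B12.RunParams) : X (leavesP w P) := by
  obtain ⟨D₅, h5, -⟩ := exists_isRecordOfRecord₅C_of_isRecordOfRecord₁₁C h
  exact h₅ D₅ w h5 P

section Transferred

variable {D : FiniteEpsData F (SU N)} {w : WorldP}

/-- Instance · GUARDED (0.20) at every Stage-11 record. [cite: Balaban1987RG1, (0.20) p.256] -/
theorem rgFlow_of_smallCouplings_of_isRecordOfRecord₁₁C (h : IsRecordOfRecord₁₁C F N D w) (P : B12.RunParams)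
    (hsc : (leavesP w P).smallCouplings) : (leavesP w P).rgFlow := by
  obtain ⟨D₅, h5, -⟩ := exists_isRecordOfRecord₅C_of_isRecordOfRecord₁₁C h
  exact rgFlow_of_smallCouplings_of_isRecordOfRecord₅C h5 P hsc

/-- Instance · N01 `Dag.B4_main` at every run of every Stage-11 record. [cite: Balaban1983RegularityDecay, Theorem p.573 (kernel version, transferred)] -/
theorem b4_main_of_isRecordOfRecord₁₁C (h : IsRecordOfRecord₁₁C F N D w) (P : B12.RunParams) : Dag.B4_main (leavesP w P) :=
  atWorld_of_isRecordOfRecord₁₁C (fun _ _ h5 P => b4_main_of_isRecordOfRecord₅C h5 P) h P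

/-- Instance · N02 `Dag.B5_main` at every run of every Stage-11 record. [cite: Balaban1984PropagatorsI, Props. 1.1–1.2 pp.33–36 (kernel versions, transferred)] -/
theorem b5_main_of_isRecordOfRecord₁₁C (h : IsRecordOfRecord₁₁C F N D w) (P : B12.RunParams) : Dag.B5_main (leavesP w P) :=
  atWorld_of_isRecordOfRecord₁₁C (fun _ _ h5 P => b5_main_of_isRecordOfRecord₅C h5 P) h P

/-- Instance · N04 `Dag.B7_main` at every run of every Stage-11 record. [cite: Balaban1985Averaging, Props. 1–10 pp.26–50 (kernel version, transferred)] -/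
theorem b7_main_of_isRecordOfRecord₁₁C (h : IsRecordOfRecord₁₁C F N D w) (P : B12.RunParams) : Dag.B7_main (leavesP w P) :=
  atWorld_of_isRecordOfRecord₁₁C (fun _ _ h5 P => b7_main_of_isRecordOfRecord₅C h5 P) h P

/-- Instance · the END headline at a Stage-11 record needs NO `rgFlow` binder. [cite: Balaban1989LargeFieldII, Thm 1 p.355 + p.391] -/
theorem endStatementBPrinted_of_isRecordOfRecord₁₁C_of_nodes (h : IsRecordOfRecord₁₁C F N D w) {γ₀ : ℝ} (hγ₀ : w.γ ≤ γ₀)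
    (hnodes : ∀ P, Nodes (leavesP w P)) (hβ : BetaBoundsInInterval w.C.toB12 γ₀ w.b w.βup) :
    B16.EndStatementBPrinted D.C := by
  obtain ⟨D₅, h5, hC5, -⟩ := exists_isRecordOfRecord₅C_of_isRecordOfRecord₁₁C h
  rw [← hC5]
  exact endStatementBPrinted_of_isRecordOfRecord₅C_of_nodes h5 hγ₀ hnodes hβ

end Transferred

/-! ## §9. The β-version faces at the Stage-11 record (Stage 10's, re-read) -/

section BetaVersion

variable {D : FiniteEpsData F (SU N)} {w : WorldP}

/-- Under the provisos, every β-input is a version of FILE 1's kernel transform AND continuous (Stage 10's face at the Stage-9 part).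
[cite: Balaban1987RG1, (0.13) p.254, (0.19) p.255 (bookkeeping)] -/
theorem betaInput_ae_eq_and_continuous₁₁ {θ : Stage11Params F N} (h : θ.Provisos₁₁) {K : ℕ} (g : ℕ → ℝ) {k : ℕ} (hk : k < K) :
    ((fun V : PBond (F.P K) (k + 1) → SU N => TcOfRecord F N K k (integrand (chiFixed7 F N θ.ν K g k) (gfOfRecord F N K k) (g k)
        (effActionHT F N (TcOfRecord F N) (chiFixed7 F N θ.ν) K g k)) V) =ᵐ[piHaar (F.P K) (k + 1) (SU N)]
      (fun V => transportOfRecord F N K k (integrand (chiFixed7 F N θ.ν K g k) (gfOfRecord F N K k) (g k)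
        (effActionHT F N (TcOfRecord F N) (chiFixed7 F N θ.ν) K g k)) V)) ∧
    Continuous (fun V : PBond (F.P K) (k + 1) → SU N => TcOfRecord F N K k (integrand (chiFixed7 F N θ.ν K g k) (gfOfRecord F N K k) (g k)
        (effActionHT F N (TcOfRecord F N) (chiFixed7 F N θ.ν) K g k)) V) :=
  betaInput_ae_eq_and_continuous₁₀ h.base g hk

/-- **A STAGE-11 RECORD CERTIFIES THE β-VERSION PROVISO** and names its β: `D.βfun = betaOfRecord₉c θ'`. [cite: Balaban1987RG1, (1.20)–(1.22) p.264, (0.13) p.254 (bookkeeping)] -/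
theorem exists_betaVersion_of_isRecordOfRecord₁₁C (h : IsRecordOfRecord₁₁C F N D w) :
    ∃ (θ : Stage11Params F N) (hP : θ.Provisos₁₁), θ.Admissible ∧ D = datumOfRecord₁₁ F N θ hP ∧ D.βfun = betaOfRecord₉c F N θ.toStage9Params ∧
      θ.toStage8Params.HasContTransportAlong := by
  obtain ⟨θ, hP, hθ, rfl, -⟩ := h
  exact ⟨θ, hP, hθ, rfl, rfl, hP.base.contT⟩

end BetaVersion

end Literature.MathematicalPhysics.QuantumFieldTheory.Balaban1983to89.Node00

end
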